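import Literature.Analysis.FluidPDE.DuchonRobertShellLaw
import Mathlib.MeasureTheory.Function.LpSpace.ContinuousCompMeasurePreserving
import Mathlib.MeasureTheory.Measure.RegularityCompacts
import Mathlib.Analysis.SpecialFunctions.SmoothTransition
import Mathlib.Topology.UniformSpace.UniformConvergenceTopology
import Mathlib.MeasureTheory.Integral.MeanInequalities
import Mathlib.Analysis.MeanInequalitiesPow
import HarnessLib

/-!
# Uniform Duchon–Robert defects and the 4/3 law: from mollified limits to the shell limit

Topic: Analysis/FluidPDE, proofs about the notions of `Literature.Analysis.FluidPDE.DissipationAnomaly`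
(Duchon–Robert flux `Torus.duchonRobertApprox`, defect `Torus.HasDuchonRobertDefect`, sphere-averaged
energy flux `Torus.energyFluxSphereAvg`, the predicate `Torus.HasFourThirdsLaw`, and the named fact
`Torus.HasDuchonRobertDefect.hasFourThirdsLaw`), on top of the polar-coordinates machinery of
`Literature.Analysis.FluidPDE.DuchonRobertShellLaw`. Everything here is proved.

## Why this file exists (the named fact `HasDuchonRobertDefect.hasFourThirdsLaw`)

The accepted fact `Torus.HasDuchonRobertDefect.hasFourThirdsLaw` asserts, for every weak Euler
solution `u ∈ L³((0,T) × T^d)` with Duchon–Robert defect `D`, the **existence** of the shell limit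
`lim_{ℓ→0⁺} ∫₀ᵀ∫ ℓ⁻¹ ⨍ δ_L u |δu|²(ℓω) dω ψ` and its value `−(4/d) D ψ`. The cited sources prove
less: Duchon–Robert 2000, §5 and Eyink 2003, §1 ("*Assuming that the following limit exists* …
Duchon and Robert [DR00], Section 5 show that `S(u) = −4/3 D(u)`") establish the **conditional**
law, which the tree proves in every dimension and without the Euler equation
(`Torus.HasDuchonRobertDefect.eq_of_tendsto_energyFlux`, `…hasFourThirdsLaw_of_tendsto` in
`DuchonRobertShellLaw`; `…fourThirdsLaw_of_limit` in `EyinkLocalFourFifths`, which records the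
discrepancy). The mollified limits `D_ε^φ(u) → D(u)` for all *smooth* mollifiers (the content of
`HasDuchonRobertDefect`) do **not** by themselves force the shell limit to exist (a shell function
`G(ℓ) = const + sin(1/ℓ)` is compatible with all of them): what is missing is exactly a
**uniformity in the mollifier**, which Duchon–Robert's *proof* of their Prop. 2 supplies for weak
Euler solutions (the identity `D_ε(u) = −∂ₜ(½u·u^ε) − div(…)` at scale `ε`, with the `L^{3/2}`
pressure, converges at a rate governed only by the `L³`/`L^{3/2}` translation moduli of `u`, `p`
and the support radius of `φ`).

This file isolates that uniformity as a notion and proves that it implies the shell limit: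

* `Torus.IsUnitBallMollifier φ` — mollifiers (`FluidPDE.IsMollifier`) supported in the closed unit
  ball; every mollifier is a rescaling of one (`exists_isUnitBallMollifier_mollifierScale_eq`,
  `φ^ε = (φ^{1/R})^{εR}`), and the Duchon–Robert flux only sees `φ^ε`
  (`duchonRobertApprox_congr_kernel`).
* `Torus.HasUniformDuchonRobertDefect T u D` — `∫₀ᵀ∫ D_ε^φ(u) ψ → D ψ` as `ε → 0⁺` *uniformly over
  unit-ball mollifiers `φ`* (`TendstoUniformlyOn` along `𝓝[>] 0`), with its metric form
  (`…exists_forall_abs_sub_lt`, `hasUniformDuchonRobertDefect_of_forall_exists`) and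
  `HasUniformDuchonRobertDefect.hasDuchonRobertDefect` (uniform ⇒ plain, by rescaling).
* **Main theorem** `Torus.HasUniformDuchonRobertDefect.hasFourThirdsLaw`: a uniform defect of a
  jointly measurable `u ∈ L³((0,T) × T^d)` satisfies `Torus.HasFourThirdsLaw T u D`, in every
  dimension (for `d` empty both sides vanish, `energyFluxSphereAvg_of_isEmpty`).
* Glue towards the fact: `HasFourThirdsLaw.congr_defect`,
  `HasDuchonRobertDefect.hasFourThirdsLaw_of_hasUniformDuchonRobertDefect`, and the reduction
  `Torus.hasFourThirdsLaw_of_forall_hasUniformDuchonRobertDefect`: the accepted fact follows once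
  every `L³` weak Euler solution with a defect has a uniform defect — the remaining (Euler +
  pressure) input, to be discharged from Duchon–Robert's scale-`ε` identity and the pressure fact
  `Torus.exists_pressure_of_tendsto_L3` (`DuchonRobertInviscidLimit`).

## Proof architecture of the main theorem

Fix a test function `ψ` and let `I(r) = ∫∫ ⨍ (δu(rω)·ω)|δu(rω)|² dω ψ` (`Torus.energyFluxShellPairing`, product
form; the 4/3-law quantity is `G(ℓ) = ℓ⁻¹ I(ℓ)`, `integral_inv_mul_energyFluxSphereAvg_eq`).

1. *Continuity of `I` in the scale* (`continuous_shellPairing`): the increments at scales `r`, `r₀`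
   differ by `u(t, x + π(rω)) − u(t, x + π(r₀ω))`, i.e. by `U ∘ S_r − U ∘ S_{r₀}` for the sphere shears
   `S_r` (`Torus.sphereShear`, measure preserving on `((0,T) × T^d) × S^{d-1}`), which tends to `0` in
   `L³` as `r → r₀` by Mathlib's continuity of `(g, f) ↦ g ∘ f` on `L^p × C(X,X)`
   (`tendsto_eLpNorm_comp_sphereShear_sub`); the cubic form is Lipschitz cubically
   (`abs_inner_mul_norm_sq_sub_le`) and Hölder `3, 3/2` (`lintegral_mul_add_sq_le`) gives
   `∫ |W_r − W_{r₀}| → 0`, whence continuity by `tendsto_integral_of_L1`.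
2. *Plateau mollifiers* `φ_m = ρ_m/∫ρ_m`, `ρ_m(ξ) = S(m(1 − |ξ|))` with `S = Real.smoothTransition`
   (`Torus.plateauBump`, `Torus.plateauMollifier`): smooth, radial, unit-ball mollifiers equal to a
   constant on `|ξ| ≤ 1 − 1/m`; their profiles `Φ_m` have `Φ_m' ≤ 0`, `Φ_m' = 0` off `[1 − 1/m, 1]`
   and `∫_{x>0} x^d Φ_m'(x) dx = −d/|S^{d-1}|` (`integral_pow_mul_deriv_plateauMollifier_profile`).
3. *Radial formula* (`integral_duchonRobertApprox_eq_radial`, the "Step A" of the conditional law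
   made a lemma): `∫∫ D_ε^{φ}(u) ψ = ¼|S^{d-1}| ∫_{x>0} x^d Φ'(x) G(εx) dx` for radial unit-ball `φ`.
4. *Un-averaging* (`tendsto_integral_pow_mul_deriv_profile_mul`): for `G` continuous on `(0,∞)`,
   `∫ x^d Φ_m'(x) G(εx) dx → −(d/|S^{d-1}|) G(ε)` as `m → ∞` (the kernels are nonpositive of fixed
   mass and concentrate at `x = 1`).
5. *Assembly*: uniformity gives `|¼|S^{d-1}| ∫ x^dΦ_m' G(ℓ·) − D ψ| < η` for all `m` and all
   `ℓ < ε₀`; letting `m → ∞`, `|−(d/4) G(ℓ) − D ψ| ≤ η`, i.e. `G(ℓ) → −(4/d) D ψ`.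

## Design notes

* The uniform notion quantifies over unit-ball mollifiers only; by rescaling this is no loss
  (`HasUniformDuchonRobertDefect.hasDuchonRobertDefect`), and it is the family over which the
  Duchon–Robert identity gives uniform rates.
* `HasUniformDuchonRobertDefect` is phrased with Mathlib's `TendstoUniformlyOn`; the `η–ε₀` form is
  provided both ways. It is a *predicate* with explicit binders `(T u D)` (a notion, like
  `HasDuchonRobertDefect`; nothing to discharge): for the zero field it holds iff `D` vanishes on
  test functions (`hasUniformDuchonRobertDefect_zero_iff`), so it is inhabited
  (`hasUniformDuchonRobertDefect_zero`) and not universally valid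
  (`not_hasUniformDuchonRobertDefect_zero_one`).
* Hypotheses of the main theorem are those of the conditional law in `DuchonRobertShellLaw`: joint
  measurability of the space–time lift and `∫⁻₍₀,T₎∫⁻ ‖u‖ₑ³ < ∞`; no Euler equation (it enters only
  through the uniformity, upstream).
* Auxiliary real analysis kept local and `[folklore]`: `(a+b)³ ≤ 4(a³+b³)` in `ℝ≥0∞`, the Hölder
  form `∫⁻ f (a+b)² ≤ (∫⁻ f³)^{1/3} (4(∫⁻a³ + ∫⁻b³))^{2/3}`, `eLpNorm_three_eq`.

## References

* J. Duchon, R. Robert, *Inertial energy dissipation for weak solutions of incompressible Euler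
  and Navier–Stokes equations*, Nonlinearity 13 (2000) 249–255, doi:10.1088/0951-7715/13/1/312:
  Prop. 2 and its proof (the scale-`ε` identity), §5 (the 4/3 law under the hypothesis that the
  shell limit exists). [DuchonRobert2000]
* G. L. Eyink, *Local 4/5-law and energy dissipation anomaly in turbulence*, Nonlinearity 16
  (2003) 137–145 = arXiv:nlin/0208004: §1, (1.5)–(1.6) and the sentence "Assuming that the
  following limit exists … Duchon and Robert [DR00], Section 5 show that `S(u) = −4/3 D(u)`"
  (PDF p. 3); §2, proof of Cor. 1 (polar coordinates). [Eyink2003]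
* Mathlib: `MeasureTheory.Lp.compMeasurePreserving_continuous` /
  `Filter.Tendsto.compMeasurePreservingLp` (continuity of composition in `L^p`),
  `ENNReal.lintegral_mul_le_Lp_mul_Lq` (Hölder), `Real.smoothTransition`,
  `MeasureTheory.tendsto_integral_of_L1`, `MeasureTheory.MeasurePreserving.skew_product`.
-/

noncomputable section

open MeasureTheory MeasureTheory.Measure TopologicalSpace Set Function Filter Topology Metric Module
open scoped InnerProductSpace RealInnerProductSpace ENNReal NNReal

namespace Literature.Analysis.FluidPDE.Torus

variable {d : Type*} [Fintype d]

/-! ## Mollifiers supported in the unit ball; rescaling -/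

section UnitBall

/-- The class `𝔐₁` of **mollifiers supported in the closed unit ball**: `φ ∈ C_c^∞(ℝ^d)` even,
nonnegative, `∫ φ = 1` (`FluidPDE.IsMollifier`) and `φ(ξ) = 0` for `|ξ| > 1` (the normalisation
of Duchon–Robert 2000, §2: "`φ` … with support in the unit ball"; any mollifier is a rescaling
of one of these, `exists_unitBallMollifier_mollifierScale_eq`). [folklore] -/
def IsUnitBallMollifier (φ : EuclideanSpace ℝ d → ℝ) : Prop :=
  FluidPDE.IsMollifier φ ∧ ∀ ξ, 1 < ‖ξ‖ → φ ξ = 0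

/-- A unit-ball mollifier is a mollifier. [folklore] -/
theorem IsUnitBallMollifier.isMollifier {φ : EuclideanSpace ℝ d → ℝ} (h : IsUnitBallMollifier φ) :
    FluidPDE.IsMollifier φ :=
  h.1

/-- Rescaling twice is rescaling once: `(φ^a)^b = φ^{ab}` for `a ≠ 0`, i.e.
`mollifierScale b (mollifierScale a φ) = mollifierScale (b * a) φ`… stated in the form used
below: `φ^ε = (φ^{1/R})^{εR}` for `R ≠ 0`. [folklore] -/
theorem mollifierScale_mollifierScale_inv {φ : EuclideanSpace ℝ d → ℝ} {R : ℝ} (hR : R ≠ 0)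
    (ε : ℝ) :
    FluidPDE.mollifierScale (ε * R) (FluidPDE.mollifierScale R⁻¹ φ) = FluidPDE.mollifierScale ε φ := by
  funext ξ
  simp only [FluidPDE.mollifierScale_apply, inv_inv, smul_smul, mul_pow, mul_inv]
  have hRn : (R ^ Fintype.card d)⁻¹ * (R ^ Fintype.card d) = 1 := inv_mul_cancel₀ (pow_ne_zero _ hR)
  rw [show R * (ε⁻¹ * R⁻¹) = ε⁻¹ by field_simp]
  calc (ε ^ Fintype.card d)⁻¹ * (R ^ Fintype.card d)⁻¹ * ((R⁻¹ ^ Fintype.card d)⁻¹ * φ (ε⁻¹ • ξ))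
      = (ε ^ Fintype.card d)⁻¹ * ((R ^ Fintype.card d)⁻¹ * (R ^ Fintype.card d)) * φ (ε⁻¹ • ξ) := by
        rw [inv_pow, inv_inv]; ring
    _ = (ε ^ Fintype.card d)⁻¹ * φ (ε⁻¹ • ξ) := by rw [hRn, mul_one]

/-- **Every mollifier is a rescaled unit-ball mollifier**: if `φ` is a mollifier, there are
`R > 0` and a unit-ball mollifier `φ₁` (namely `φ₁ = φ^{1/R} = R^d φ(R·)` for `supp φ ⊆ B_R`)
with `φ^ε = φ₁^{εR}` for every `ε`. [folklore] -/
theorem exists_isUnitBallMollifier_mollifierScale_eq {φ : EuclideanSpace ℝ d → ℝ}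
    (hφ : FluidPDE.IsMollifier φ) :
    ∃ R : ℝ, 0 < R ∧ ∃ φ₁ : EuclideanSpace ℝ d → ℝ, IsUnitBallMollifier φ₁ ∧
      ∀ ε, FluidPDE.mollifierScale ε φ = FluidPDE.mollifierScale (ε * R) φ₁ := by
  obtain ⟨R₀, hR₀⟩ := hφ.2.1.isCompact.isBounded.subset_closedBall 0
  set R : ℝ := max R₀ 1 with hRdef
  have hR : 0 < R := one_pos.trans_le (le_max_right _ _)
  have hsupp : ∀ ξ, R < ‖ξ‖ → φ ξ = 0 := fun ξ hξ => by
    by_contra h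
    have : ξ ∈ closedBall (0 : EuclideanSpace ℝ d) R₀ := hR₀ (subset_tsupport _ (mem_support.2 h))
    rw [mem_closedBall, dist_zero_right] at this
    exact absurd (this.trans (le_max_left _ _)) (not_le.2 hξ)
  refine ⟨R, hR, FluidPDE.mollifierScale R⁻¹ φ, ⟨hφ.mollifierScale (inv_pos.2 hR), fun ξ hξ => ?_⟩,
    fun ε => (mollifierScale_mollifierScale_inv hR.ne' ε).symm⟩
  rw [FluidPDE.mollifierScale_apply, inv_inv, hsupp _ ?_, mul_zero]
  rw [norm_smul, Real.norm_eq_abs, abs_of_pos hR]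
  calc R = R * 1 := (mul_one R).symm
    _ < R * ‖ξ‖ := by gcongr

/-- The Duchon–Robert flux depends on `(φ, ε)` only through the rescaled kernel `φ^ε`. [folklore] -/
theorem duchonRobertApprox_congr_kernel {φ φ' : EuclideanSpace ℝ d → ℝ} {ε ε' : ℝ}
    (h : FluidPDE.mollifierScale ε φ = FluidPDE.mollifierScale ε' φ')
    (w : UnitAddTorus d → EuclideanSpace ℝ d) (x : UnitAddTorus d) :
    duchonRobertApprox φ ε w x = duchonRobertApprox φ' ε' w x := by
  simp only [duchonRobertApprox, h]

end UnitBall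

/-! ## Uniform Duchon–Robert defects -/

section Uniform

variable {T : ℝ} {u : ℝ → UnitAddTorus d → EuclideanSpace ℝ d} {D : STFunctional d}

/-- **Uniform Duchon–Robert defect.** `D` is the Duchon–Robert defect of `u` on `(0,T) × T^d`
*uniformly in the mollifier*: for every test function `ψ` supported in `(0,T)`,
`∫₀ᵀ∫ D_ε^φ(u) ψ → D ψ` as `ε → 0⁺` **uniformly over all mollifiers `φ` supported in the unit
ball** (`IsUnitBallMollifier`), in the sense of `TendstoUniformlyOn`. This is the mode of
convergence that Duchon–Robert's proof of their Prop. 2 actually yields for `L³` weak Euler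
solutions (the limit is reached through the local energy identity at scale `ε`, whose right-hand
side converges at a rate controlled by the `L³`/`L^{3/2}` translation moduli of `u` and `p` and
the support radius of `φ` only), and it is exactly what upgrades the mollified limits to the
shell limit of the 4/3 law (`HasUniformDuchonRobertDefect.hasFourThirdsLaw`). It implies the
plain defect property `HasDuchonRobertDefect T u D` (`HasUniformDuchonRobertDefect.hasDuchonRobertDefect`).
A *predicate* on `(T, u, D)` (explicit binders, like `HasDuchonRobertDefect`), not a closed
statement: the zero field has uniform defect `D` iff `D` annihilates the test functions
(`hasUniformDuchonRobertDefect_zero_iff`, `not_hasUniformDuchonRobertDefect_zero_one`). [folklore] -/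
def HasUniformDuchonRobertDefect (T : ℝ) (u : ℝ → UnitAddTorus d → EuclideanSpace ℝ d)
    (D : STFunctional d) : Prop :=
  ∀ ψ : ℝ → UnitAddTorus d → ℝ, FunctionSpaces.Torus.IsSpaceTimeTestIoo T ψ →
    TendstoUniformlyOn
      (fun (ε : ℝ) (φ : EuclideanSpace ℝ d → ℝ) =>
        ∫ t in Ioo 0 T, ∫ x, duchonRobertApprox φ ε (u t) x * ψ t x)
      (fun _ => D ψ) (𝓝[>] 0) {φ | IsUnitBallMollifier φ}

/-- Metric form of the uniform defect property: for every `η > 0` there is `ε₀ > 0` such that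
`|∫₀ᵀ∫ D_ε^φ(u) ψ − D ψ| < η` for all unit-ball mollifiers `φ` and all `ε ∈ (0, ε₀)`. [folklore] -/
theorem HasUniformDuchonRobertDefect.exists_forall_abs_sub_lt (h : HasUniformDuchonRobertDefect T u D)
    {ψ : ℝ → UnitAddTorus d → ℝ} (hψ : FunctionSpaces.Torus.IsSpaceTimeTestIoo T ψ) {η : ℝ}
    (hη : 0 < η) :
    ∃ ε₀ > 0, ∀ φ, IsUnitBallMollifier φ → ∀ ε ∈ Ioo 0 ε₀,
      |(∫ t in Ioo 0 T, ∫ x, duchonRobertApprox φ ε (u t) x * ψ t x) - D ψ| < η := by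
  have h1 := (Metric.tendstoUniformlyOn_iff.1 (h ψ hψ)) η hη
  obtain ⟨ε₀, hε₀, hsub⟩ := mem_nhdsGT_iff_exists_Ioo_subset.1 h1
  refine ⟨ε₀, hε₀, fun φ hφ ε hε => ?_⟩
  have := hsub hε φ hφ
  rwa [Real.dist_eq, abs_sub_comm] at this

/-- Conversely, the metric form implies the uniform defect property. [folklore] -/
theorem hasUniformDuchonRobertDefect_of_forall_exists
    (h : ∀ ψ : ℝ → UnitAddTorus d → ℝ, FunctionSpaces.Torus.IsSpaceTimeTestIoo T ψ → ∀ η > 0,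
      ∃ ε₀ > 0, ∀ φ, IsUnitBallMollifier φ → ∀ ε ∈ Ioo 0 ε₀,
        |(∫ t in Ioo 0 T, ∫ x, duchonRobertApprox φ ε (u t) x * ψ t x) - D ψ| < η) :
    HasUniformDuchonRobertDefect T u D := by
  intro ψ hψ
  refine Metric.tendstoUniformlyOn_iff.2 fun η hη => ?_
  obtain ⟨ε₀, hε₀, hb⟩ := h ψ hψ η hη
  filter_upwards [Ioo_mem_nhdsGT hε₀] with ε hε φ hφ
  rw [Real.dist_eq, abs_sub_comm]
  exact hb φ hφ ε hε

/-- **A uniform defect is a defect**: `HasUniformDuchonRobertDefect T u D → HasDuchonRobertDefect T u D`.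
For a unit-ball mollifier this is uniform ⇒ pointwise convergence; a general mollifier `φ` is a
rescaled unit-ball mollifier, `φ^ε = φ₁^{εR}` (`exists_isUnitBallMollifier_mollifierScale_eq`),
and `ε ↦ εR` preserves `ε → 0⁺`. [folklore] -/
theorem HasUniformDuchonRobertDefect.hasDuchonRobertDefect (h : HasUniformDuchonRobertDefect T u D) :
    HasDuchonRobertDefect T u D := by
  intro φ hφ ψ hψ
  obtain ⟨R, hR, φ₁, hφ₁, hscale⟩ := exists_isUnitBallMollifier_mollifierScale_eq hφ
  rw [Metric.tendsto_nhds]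
  intro η hη
  obtain ⟨ε₀, hε₀, hb⟩ := h.exists_forall_abs_sub_lt hψ hη
  filter_upwards [Ioo_mem_nhdsGT (div_pos hε₀ hR)] with ε hε
  have hεR : ε * R ∈ Ioo 0 ε₀ := ⟨mul_pos hε.1 hR, (lt_div_iff₀ hR).1 hε.2⟩
  have heq : (∫ t in Ioo 0 T, ∫ x, duchonRobertApprox φ ε (u t) x * ψ t x) =
      ∫ t in Ioo 0 T, ∫ x, duchonRobertApprox φ₁ (ε * R) (u t) x * ψ t x := by
    simp only [duchonRobertApprox_congr_kernel (hscale ε)]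
  rw [Real.dist_eq, heq]
  exact hb φ₁ hφ₁ _ hεR

end Uniform

/-! ## Plateau mollifiers: smooth radial profiles increasing to the indicator of the unit ball -/

section Plateau

open scoped ContDiff

variable {E : Type*} [NormedAddCommGroup E]

/-- The **plateau bump** `ρ_m(ξ) = S(m(1 − |ξ|))`, `S = Real.smoothTransition`: a radial `C^∞`
function with `0 ≤ ρ_m ≤ 1`, `ρ_m = 1` on the ball `|ξ| ≤ 1 − 1/m` and `ρ_m = 0` for `|ξ| ≥ 1`
(`m > 1`). As `m → ∞`, `ρ_m ↑ 𝟙_{B₁}`: the device replacing the (non-smooth) top-hat kernel of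
the 4/3 law by admissible mollifiers. [folklore] -/
def plateauBump (m : ℝ) (ξ : E) : ℝ :=
  Real.smoothTransition (m * (1 - ‖ξ‖))

/-- Unfolding the plateau bump. [folklore] -/
theorem plateauBump_apply (m : ℝ) (ξ : E) :
    plateauBump m ξ = Real.smoothTransition (m * (1 - ‖ξ‖)) :=
  rfl

/-- The plateau bump is nonnegative. [folklore] -/
theorem plateauBump_nonneg (m : ℝ) (ξ : E) : 0 ≤ plateauBump m ξ :=
  Real.smoothTransition.nonneg _

/-- The plateau bump is at most `1`. [folklore] -/
theorem plateauBump_le_one (m : ℝ) (ξ : E) : plateauBump m ξ ≤ 1 :=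
  Real.smoothTransition.le_one _

/-- `ρ_m = 1` on the closed ball of radius `1 − 1/m`. [folklore] -/
theorem plateauBump_eq_one {m : ℝ} (hm : 0 < m) {ξ : E} (h : ‖ξ‖ ≤ 1 - m⁻¹) : plateauBump m ξ = 1 := by
  refine Real.smoothTransition.one_of_one_le ?_
  calc (1 : ℝ) = m * m⁻¹ := (mul_inv_cancel₀ hm.ne').symm
    _ ≤ m * (1 - ‖ξ‖) := by gcongr; linarith

/-- `ρ_m = 0` off the open unit ball. [folklore] -/
theorem plateauBump_eq_zero {m : ℝ} (hm : 0 ≤ m) {ξ : E} (h : 1 ≤ ‖ξ‖) : plateauBump m ξ = 0 :=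
  Real.smoothTransition.zero_of_nonpos (mul_nonpos_of_nonneg_of_nonpos hm (by linarith))

/-- The plateau bump is spherically symmetric. [folklore] -/
theorem plateauBump_radial (m : ℝ) {x y : E} (h : ‖x‖ = ‖y‖) : plateauBump m x = plateauBump m y := by
  rw [plateauBump_apply, plateauBump_apply, h]

/-- The plateau bump is even. [folklore] -/
theorem plateauBump_neg (m : ℝ) (ξ : E) : plateauBump m (-ξ) = plateauBump m ξ :=
  plateauBump_radial m (norm_neg ξ)

variable [InnerProductSpace ℝ E]

/-- The plateau bump is smooth for `m > 1`: near the origin it is locally constant, elsewhere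
the norm is smooth. [folklore] -/
theorem contDiff_plateauBump {m : ℝ} (hm : 1 < m) : ContDiff ℝ ∞ (plateauBump m : E → ℝ) := by
  have hm0 : 0 < m := one_pos.trans hm
  have hr : 0 < 1 - m⁻¹ := by
    have : m⁻¹ < 1 := inv_lt_one_of_one_lt₀ hm
    linarith
  refine contDiff_iff_contDiffAt.2 fun ξ => ?_
  by_cases hξ : ‖ξ‖ < 1 - m⁻¹
  · -- locally constant `= 1`
    have hev : (plateauBump m : E → ℝ) =ᶠ[𝓝 ξ] fun _ => 1 := by
      have ho : IsOpen {x : E | ‖x‖ < 1 - m⁻¹} := isOpen_lt continuous_norm continuous_const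
      filter_upwards [ho.mem_nhds hξ] with x hx
      exact plateauBump_eq_one hm0 (le_of_lt hx)
    exact (contDiffAt_const (c := (1 : ℝ))).congr_of_eventuallyEq hev
  · have hξ0 : ξ ≠ 0 := by
      rintro rfl
      exact hξ (by simpa using hr)
    have h1 : ContDiffAt ℝ ∞ (fun x : E => m * (1 - ‖x‖)) ξ :=
      contDiffAt_const.mul (contDiffAt_const.sub (contDiffAt_norm ℝ hξ0))
    exact Real.smoothTransition.contDiffAt.comp ξ h1

/-- The plateau bump is continuous (`m > 1`). [folklore] -/
theorem continuous_plateauBump {m : ℝ} (hm : 1 < m) : Continuous (plateauBump m : E → ℝ) :=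
  (contDiff_plateauBump hm).continuous

variable [FiniteDimensional ℝ E]

/-- The plateau bump is supported in the closed unit ball. [folklore] -/
theorem hasCompactSupport_plateauBump {m : ℝ} (hm : 0 ≤ m) : HasCompactSupport (plateauBump m : E → ℝ) := by
  refine HasCompactSupport.intro (isCompact_closedBall (0 : E) 1) fun ξ hξ => ?_
  exact plateauBump_eq_zero hm (le_of_lt (by simpa [dist_zero_right] using hξ))

variable [MeasurableSpace E] [BorelSpace E] (μ : Measure E) [μ.IsAddHaarMeasure]

/-- The plateau bump is integrable against any additive Haar measure. [folklore] -/
theorem integrable_plateauBump {m : ℝ} (hm : 1 < m) : Integrable (plateauBump m : E → ℝ) μ :=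
  (continuous_plateauBump hm).integrable_of_hasCompactSupport
    (hasCompactSupport_plateauBump (zero_le_one.trans hm.le))

/-- The plateau bump has positive mass (it is `1` on a ball of positive radius). [folklore] -/
theorem integral_plateauBump_pos [Nontrivial E] {m : ℝ} (hm : 1 < m) : 0 < ∫ ξ, plateauBump m ξ ∂μ := by
  have hm0 : 0 < m := one_pos.trans hm
  have hr : 0 < 1 - m⁻¹ := by
    have : m⁻¹ < 1 := inv_lt_one_of_one_lt₀ hm
    linarith
  rw [integral_pos_iff_support_of_nonneg (plateauBump_nonneg m) (integrable_plateauBump μ hm)]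
  have hsub : ball (0 : E) (1 - m⁻¹) ⊆ support (plateauBump m) := fun ξ hξ => by
    rw [mem_support, plateauBump_eq_one hm0 (by simpa [dist_zero_right] using (mem_ball.1 hξ).le)]
    exact one_ne_zero
  exact (measure_ball_pos μ (0 : E) hr).trans_le (measure_mono hsub)

end Plateau

/-! ## Plateau mollifiers on `ℝ^d` and their profiles -/

section PlateauMollifier

open scoped ContDiff

variable (d) in
/-- The **plateau mollifier** `φ_m = ρ_m / ∫ ρ_m` on `ℝ^d`: a unit-ball mollifier
(`isUnitBallMollifier_plateauMollifier`), radial, equal to the constant `(∫ ρ_m)⁻¹` on the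
ball of radius `1 − 1/m` and vanishing outside the unit ball (`m > 1`, `d` nonempty). [folklore] -/
def plateauMollifier (m : ℝ) (ξ : EuclideanSpace ℝ d) : ℝ :=
  (∫ η : EuclideanSpace ℝ d, plateauBump m η)⁻¹ * plateauBump m ξ

/-- Unfolding the plateau mollifier. [folklore] -/
theorem plateauMollifier_apply (m : ℝ) (ξ : EuclideanSpace ℝ d) :
    plateauMollifier d m ξ = (∫ η : EuclideanSpace ℝ d, plateauBump m η)⁻¹ * plateauBump m ξ :=
  rfl

/-- The plateau mollifier is spherically symmetric. [folklore] -/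
theorem plateauMollifier_radial (m : ℝ) {x y : EuclideanSpace ℝ d} (h : ‖x‖ = ‖y‖) :
    plateauMollifier d m x = plateauMollifier d m y := by
  rw [plateauMollifier_apply, plateauMollifier_apply, plateauBump_radial m h]

/-- The plateau mollifier vanishes off the open unit ball. [folklore] -/
theorem plateauMollifier_eq_zero {m : ℝ} (hm : 0 ≤ m) {ξ : EuclideanSpace ℝ d} (h : 1 ≤ ‖ξ‖) :
    plateauMollifier d m ξ = 0 := by
  rw [plateauMollifier_apply, plateauBump_eq_zero hm h, mul_zero]

/-- Plateau mollifiers are unit-ball mollifiers (`d` nonempty, `m > 1`). [folklore] -/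
theorem isUnitBallMollifier_plateauMollifier [Nonempty d] {m : ℝ} (hm : 1 < m) :
    IsUnitBallMollifier (plateauMollifier d m) := by
  have hpos := integral_plateauBump_pos (volume : Measure (EuclideanSpace ℝ d)) hm
  refine ⟨⟨contDiff_const.mul (contDiff_plateauBump hm),
    (hasCompactSupport_plateauBump (zero_le_one.trans hm.le)).mul_left, fun ξ => ?_, fun ξ => ?_, ?_⟩,
    fun ξ hξ => plateauMollifier_eq_zero (zero_le_one.trans hm.le) hξ.le⟩
  · rw [plateauMollifier_apply, plateauMollifier_apply, plateauBump_neg]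
  · exact mul_nonneg (inv_nonneg.2 hpos.le) (plateauBump_nonneg m ξ)
  · show ∫ ξ, (∫ η : EuclideanSpace ℝ d, plateauBump m η)⁻¹ * plateauBump m ξ = 1
    rw [integral_const_mul, inv_mul_cancel₀ hpos.ne']

end PlateauMollifier

/-! ## Profiles of the plateau mollifiers -/

section Profile

open scoped ContDiff

variable {m : ℝ} {e₀ : EuclideanSpace ℝ d}

/-- On `r > 0` the profile of the plateau mollifier is `a_m S(m(1 − r))`, `a_m = (∫ ρ_m)⁻¹`. [folklore] -/
theorem plateauMollifier_smul_of_pos (he₀ : ‖e₀‖ = 1) {r : ℝ} (hr : 0 < r) :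
    plateauMollifier d m (r • e₀) =
      (∫ η : EuclideanSpace ℝ d, plateauBump m η)⁻¹ * Real.smoothTransition (m * (1 - r)) := by
  rw [plateauMollifier_apply, plateauBump_apply, norm_smul, he₀, mul_one, Real.norm_eq_abs,
    abs_of_pos hr]

/-- The profile `r ↦ φ_m(r e₀)` is `C¹` (indeed smooth) for `m > 1`. [folklore] -/
theorem contDiff_plateauMollifier_profile (hm : 1 < m) (e₀ : EuclideanSpace ℝ d) :
    ContDiff ℝ 1 fun r : ℝ => plateauMollifier d m (r • e₀) :=
  ((contDiff_const.mul (contDiff_plateauBump hm)).of_le (by simp)).comp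
    (contDiff_id.smul contDiff_const)

/-- The profile vanishes for `r > 1`. [folklore] -/
theorem plateauMollifier_profile_eq_zero (hm : 0 ≤ m) (he₀ : ‖e₀‖ = 1) {r : ℝ} (hr : 1 < r) :
    plateauMollifier d m (r • e₀) = 0 :=
  plateauMollifier_eq_zero hm
    (by rw [norm_smul, he₀, mul_one, Real.norm_eq_abs]; exact hr.le.trans (le_abs_self r))

/-- **The profile is non-increasing on `(0, ∞)`**: `Φ_m'(r) ≤ 0` for `r > 0` (chain rule and
`S' ≥ 0`). [folklore] -/
theorem deriv_plateauMollifier_profile_nonpos (hm : 1 < m) (he₀ : ‖e₀‖ = 1) {r : ℝ} (hr : 0 < r) :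
    deriv (fun s : ℝ => plateauMollifier d m (s • e₀)) r ≤ 0 := by
  set a : ℝ := (∫ η : EuclideanSpace ℝ d, plateauBump m η)⁻¹ with ha
  have ha0 : 0 ≤ a := by
    by_cases hd : Nonempty d
    · exact inv_nonneg.2 (integral_plateauBump_pos volume hm).le
    · rw [not_nonempty_iff] at hd
      exact inv_nonneg.2 (integral_nonneg fun η => plateauBump_nonneg m η)
  -- locally, the profile is `a * S (m (1 - s))`
  have hev : (fun s : ℝ => plateauMollifier d m (s • e₀)) =ᶠ[𝓝 r]
      fun s => a * Real.smoothTransition (m * (1 - s)) := by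
    filter_upwards [Ioi_mem_nhds hr] with s hs
    exact plateauMollifier_smul_of_pos he₀ hs
  rw [hev.deriv_eq]
  have hS : HasDerivAt Real.smoothTransition (deriv Real.smoothTransition (m * (1 - r))) (m * (1 - r)) :=
    ((Real.smoothTransition.contDiffAt (n := 1)).differentiableAt one_ne_zero).hasDerivAt
  have hlin : HasDerivAt (fun s : ℝ => m * (1 - s)) (m * (0 - 1)) r :=
    ((hasDerivAt_const r (1 : ℝ)).sub (hasDerivAt_id r)).const_mul m
  have hcomp := (hS.comp r hlin).const_mul a
  rw [show (fun s : ℝ => a * Real.smoothTransition (m * (1 - s))) =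
      fun s => a * (Real.smoothTransition ∘ fun s : ℝ => m * (1 - s)) s from rfl, hcomp.deriv]
  have hS' : 0 ≤ deriv Real.smoothTransition (m * (1 - r)) := Real.smoothTransition.monotone.deriv_nonneg
  have hm0 : 0 ≤ m := zero_le_one.trans hm.le
  nlinarith [mul_nonneg ha0 hS', mul_nonneg (mul_nonneg ha0 hS') hm0]

/-- The profile is locally constant, hence has zero derivative, on the plateau `(0, 1 − 1/m)`. [folklore] -/
theorem deriv_plateauMollifier_profile_eq_zero_of_lt (hm : 1 < m) (he₀ : ‖e₀‖ = 1) {r : ℝ}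
    (hr : 0 < r) (hr' : r < 1 - m⁻¹) :
    deriv (fun s : ℝ => plateauMollifier d m (s • e₀)) r = 0 := by
  have hm0 : 0 < m := one_pos.trans hm
  have hev : (fun s : ℝ => plateauMollifier d m (s • e₀)) =ᶠ[𝓝 r]
      fun _ => (∫ η : EuclideanSpace ℝ d, plateauBump m η)⁻¹ := by
    filter_upwards [Ioi_mem_nhds hr, Iio_mem_nhds hr'] with s hs hs'
    rw [plateauMollifier_apply, plateauBump_eq_one hm0, mul_one]
    rw [norm_smul, he₀, mul_one, Real.norm_eq_abs, abs_of_pos hs]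
    exact hs'.le
  rw [hev.deriv_eq, deriv_const]

/-- The profile has zero derivative for `r > 1`. [folklore] -/
theorem deriv_plateauMollifier_profile_eq_zero_of_gt (hm : 0 ≤ m) (he₀ : ‖e₀‖ = 1) {r : ℝ}
    (hr : 1 < r) :
    deriv (fun s : ℝ => plateauMollifier d m (s • e₀)) r = 0 :=
  deriv_eq_zero_of_forall_gt (fun _ hs => plateauMollifier_profile_eq_zero hm he₀ hs) hr

/-- **Mass of the derivative kernel**: `∫_{x>0} x^d Φ_m'(x) dx = −d / |S^{d-1}|` for the profile
`Φ_m` of the plateau mollifier (radial integration by parts `∫ x^d Φ' = −d ∫ x^{d-1} Φ` and unit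
mass `|S^{d-1}| ∫ x^{d-1} Φ = 1`). [folklore] -/
theorem integral_pow_mul_deriv_plateauMollifier_profile [Nonempty d] (hm : 1 < m) (he₀ : ‖e₀‖ = 1) :
    ∫ x in Ioi (0 : ℝ), x ^ Fintype.card d * deriv (fun s : ℝ => plateauMollifier d m (s • e₀)) x =
      -(Fintype.card d : ℝ) / (volume : Measure (EuclideanSpace ℝ d)).toSphere.real univ := by
  have hn : 1 ≤ Fintype.card d := Fintype.card_pos
  have hmol := isUnitBallMollifier_plateauMollifier (d := d) hm
  have h1 := integral_Ioi_pow_mul_deriv (contDiff_plateauMollifier_profile hm e₀) (R := 2) two_pos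
    (fun r hr => plateauMollifier_profile_eq_zero (zero_le_one.trans hm.le) he₀ (by linarith)) hn
  have h2 := toSphere_real_univ_mul_integral_profile volume (fun x y h => plateauMollifier_radial m h)
    he₀ hmol.1.2.2.2.2
  rw [finrank_euclideanSpace] at h2
  have hc : (volume : Measure (EuclideanSpace ℝ d)).toSphere.real univ ≠ 0 := toSphere_real_univ_pos.ne'
  rw [h1, eq_div_iff hc]
  calc -(Fintype.card d : ℝ) * (∫ x in Ioi (0 : ℝ), x ^ (Fintype.card d - 1) * plateauMollifier d m (x • e₀)) *
        (volume : Measure (EuclideanSpace ℝ d)).toSphere.real univ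
      = -(Fintype.card d : ℝ) * ((volume : Measure (EuclideanSpace ℝ d)).toSphere.real univ *
          ∫ x in Ioi (0 : ℝ), x ^ (Fintype.card d - 1) * plateauMollifier d m (x • e₀)) := by ring
    _ = -(Fintype.card d : ℝ) := by rw [h2, mul_one]

/-- The profile vanishes for `|r| > 1`. [folklore] -/
theorem plateauMollifier_profile_eq_zero_of_abs (hm : 0 ≤ m) (he₀ : ‖e₀‖ = 1) {r : ℝ} (hr : 1 < |r|) :
    plateauMollifier d m (r • e₀) = 0 :=
  plateauMollifier_eq_zero hm (by rw [norm_smul, he₀, mul_one, Real.norm_eq_abs]; exact hr.le)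

/-- The derivative kernel `x ↦ x^d Φ_m'(x)` is continuous, compactly supported, hence integrable. [folklore] -/
theorem integrable_pow_mul_deriv_plateauMollifier_profile (hm : 1 < m) (he₀ : ‖e₀‖ = 1) :
    Integrable (fun x : ℝ => x ^ Fintype.card d * deriv (fun s : ℝ => plateauMollifier d m (s • e₀)) x) volume := by
  have hm0 : 0 ≤ m := zero_le_one.trans hm.le
  have hc : Continuous fun x : ℝ => x ^ Fintype.card d * deriv (fun s : ℝ => plateauMollifier d m (s • e₀)) x :=
    (continuous_pow _).mul ((contDiff_plateauMollifier_profile hm e₀).continuous_deriv le_rfl)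
  refine hc.integrable_of_hasCompactSupport ?_
  refine HasCompactSupport.intro (isCompact_Icc (a := -1) (b := 1)) fun x hx => ?_
  simp only [mem_Icc, not_and_or, not_le] at hx
  have hzero : deriv (fun s : ℝ => plateauMollifier d m (s • e₀)) x = 0 := by
    rcases hx with hx | hx
    · have : deriv (fun s : ℝ => plateauMollifier d m (s • e₀)) x = deriv (fun _ => (0 : ℝ)) x := by
        refine Filter.EventuallyEq.deriv_eq ?_
        filter_upwards [Iio_mem_nhds hx] with s hs
        have hs' : s < -1 := hs
        exact plateauMollifier_profile_eq_zero_of_abs hm0 he₀ (by rw [abs_of_neg (by linarith)]; linarith)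
      rw [this, deriv_const]
    · exact deriv_plateauMollifier_profile_eq_zero_of_gt hm0 he₀ hx
  rw [hzero, mul_zero]

end Profile

/-! ## Un-averaging against the plateau kernels -/

section Unaverage

variable {e₀ : EuclideanSpace ℝ d}

/-- **Un-averaging lemma.** For `G` continuous on `(0, ∞)` and `ε > 0`, the pairings of
`x ↦ G(εx)` with the derivative kernels `x^d Φ_m'(x)` of the plateau mollifiers (`m = k + 2`)
converge to `−(d/|S^{d-1}|) G(ε)` as `k → ∞`: the kernels are nonpositive, of total mass
`−d/|S^{d-1}|` (`integral_pow_mul_deriv_plateauMollifier_profile`) and supported in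
`[1 − 1/m, 1]`, which shrinks to the point `1`. [folklore] -/
theorem tendsto_integral_pow_mul_deriv_profile_mul [Nonempty d] (he₀ : ‖e₀‖ = 1) {G : ℝ → ℝ}
    (hG : ContinuousOn G (Ioi 0)) {ε : ℝ} (hε : 0 < ε) :
    Tendsto (fun k : ℕ => ∫ x in Ioi (0 : ℝ), x ^ Fintype.card d *
        deriv (fun s : ℝ => plateauMollifier d ((k : ℝ) + 2) (s • e₀)) x * G (ε * x)) atTop
      (𝓝 (-(Fintype.card d : ℝ) / (volume : Measure (EuclideanSpace ℝ d)).toSphere.real univ * G ε)) := by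
  set n : ℕ := Fintype.card d with hndef
  set c : ℝ := (volume : Measure (EuclideanSpace ℝ d)).toSphere.real univ with hcdef
  have hc : 0 < c := toSphere_real_univ_pos
  have hn : 1 ≤ n := Fintype.card_pos
  set κ : ℝ := (n : ℝ) / c with hκ
  have hκ0 : 0 < κ := div_pos (by exact_mod_cast hn) hc
  -- the kernels
  set K : ℕ → ℝ → ℝ := fun k x => x ^ n * deriv (fun s : ℝ => plateauMollifier d ((k : ℝ) + 2) (s • e₀)) x
    with hKdef
  have hm : ∀ k : ℕ, (1 : ℝ) < (k : ℝ) + 2 := fun k => by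
    have : (0 : ℝ) ≤ k := Nat.cast_nonneg k
    linarith
  have hm0 : ∀ k : ℕ, (0 : ℝ) ≤ (k : ℝ) + 2 := fun k => zero_le_one.trans (hm k).le
  have hminv : ∀ k : ℕ, (1 : ℝ) - ((k : ℝ) + 2)⁻¹ ≥ 2⁻¹ := fun k => by
    have h2 : (2 : ℝ) ≤ (k : ℝ) + 2 := by have : (0 : ℝ) ≤ k := Nat.cast_nonneg k; linarith
    have : ((k : ℝ) + 2)⁻¹ ≤ 2⁻¹ := inv_anti₀ two_pos h2
    linarith
  have hKc : ∀ k, Continuous (K k) := fun k =>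
    (continuous_pow _).mul ((contDiff_plateauMollifier_profile (hm k) e₀).continuous_deriv le_rfl)
  have hKnonpos : ∀ k, ∀ x, 0 < x → K k x ≤ 0 := fun k x hx =>
    mul_nonpos_of_nonneg_of_nonpos (pow_nonneg hx.le _) (deriv_plateauMollifier_profile_nonpos (hm k) he₀ hx)
  have hKzero_lt : ∀ (k : ℕ) (x : ℝ), 0 < x → x < 1 - ((k : ℝ) + 2)⁻¹ → K k x = 0 := fun k x hx hx' => by
    simp only [hKdef]
    rw [deriv_plateauMollifier_profile_eq_zero_of_lt (hm k) he₀ hx hx', mul_zero]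
  have hKzero_gt : ∀ (k : ℕ) (x : ℝ), 1 < x → K k x = 0 := fun k x hx => by
    simp only [hKdef]
    rw [deriv_plateauMollifier_profile_eq_zero_of_gt (hm0 k) he₀ hx, mul_zero]
  have hKint : ∀ k, Integrable (K k) volume := fun k =>
    integrable_pow_mul_deriv_plateauMollifier_profile (hm k) he₀
  have hKmass : ∀ k, ∫ x in Ioi (0 : ℝ), K k x = -κ := fun k => by
    simp only [hKdef, hκ]
    rw [integral_pow_mul_deriv_plateauMollifier_profile (hm k) he₀, neg_div]
  -- integrability of the pairings on `(0, ∞)`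
  have hGε : ContinuousOn (fun x : ℝ => G (ε * x)) (Ioi 0) :=
    hG.comp (continuous_const.mul continuous_id).continuousOn fun x hx => mul_pos hε hx
  have hKGint : ∀ k, IntegrableOn (fun x => K k x * G (ε * x)) (Ioi 0) := by
    intro k
    have h1 : IntegrableOn (fun x => K k x * G (ε * x)) (Icc 2⁻¹ 1) := by
      refine ContinuousOn.integrableOn_Icc ?_
      exact ((hKc k).continuousOn.mul (hGε.mono fun x hx => lt_of_lt_of_le (by norm_num) hx.1))
    refine h1.of_forall_sdiff_eq_zero measurableSet_Ioi fun x hx => ?_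
    have hx0 : (0 : ℝ) < x := hx.1
    have hx' : ¬(2⁻¹ ≤ x ∧ x ≤ 1) := hx.2
    rcases not_and_or.1 hx' with hx2 | hx2
    · rw [hKzero_lt k x hx0 ((not_le.1 hx2).trans_le (hminv k)), zero_mul]
    · rw [hKzero_gt k x (not_le.1 hx2), zero_mul]
  -- the `ε–N` argument
  rw [Metric.tendsto_atTop]
  intro η hη
  set η' : ℝ := η / (2 * κ) with hη'
  have hη'0 : 0 < η' := div_pos hη (mul_pos two_pos hκ0)
  obtain ⟨δ, hδ, hGδ⟩ : ∃ δ > 0, ∀ y, |y - ε| < δ → |G y - G ε| < η' := by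
    have hca : ContinuousAt G ε := hG.continuousAt (Ioi_mem_nhds hε)
    have := Metric.continuousAt_iff.1 hca η' hη'0
    obtain ⟨δ, hδ, h⟩ := this
    exact ⟨δ, hδ, fun y hy => by simpa [Real.dist_eq] using h (by simpa [Real.dist_eq] using hy)⟩
  obtain ⟨N, hN⟩ : ∃ N : ℕ, ε / δ < (N : ℝ) + 2 := by
    obtain ⟨N, hN⟩ := exists_nat_gt (ε / δ)
    exact ⟨N, by linarith⟩
  refine ⟨N, fun k hk => ?_⟩
  have hmk : ε / δ < (k : ℝ) + 2 := hN.trans_le (by exact_mod_cast Nat.add_le_add_right hk 2)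
  have hmk0 : (0 : ℝ) < (k : ℝ) + 2 := by linarith [hm k]
  -- pointwise bound on `(0, ∞)`
  have hpt : ∀ x, 0 < x → |K k x * (G (ε * x) - G ε)| ≤ -K k x * η' := by
    intro x hx
    by_cases hKx : K k x = 0
    · simp [hKx]
    · have hx1 : x ≤ 1 := by
        by_contra h
        exact hKx (hKzero_gt k x (not_le.1 h))
      have hx2 : 1 - ((k : ℝ) + 2)⁻¹ ≤ x := by
        by_contra h
        exact hKx (hKzero_lt k x hx (not_le.1 h))
      have hclose : |ε * x - ε| < δ := by
        rw [show ε * x - ε = -(ε * (1 - x)) by ring, abs_neg, abs_of_nonneg (mul_nonneg hε.le (by linarith))]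
        calc ε * (1 - x) ≤ ε * ((k : ℝ) + 2)⁻¹ := by gcongr; linarith
          _ < δ := by
            rw [← div_eq_mul_inv, div_lt_iff₀ hmk0]
            calc ε = ε / δ * δ := (div_mul_cancel₀ ε hδ.ne').symm
              _ < ((k : ℝ) + 2) * δ := by gcongr
              _ = δ * ((k : ℝ) + 2) := mul_comm _ _
      have hG' := (hGδ (ε * x) hclose).le
      rw [abs_mul, abs_of_nonpos (hKnonpos k x hx)]
      exact mul_le_mul_of_nonneg_left hG' (neg_nonneg.2 (hKnonpos k x hx))
  -- integrate
  have hdiff : (∫ x in Ioi (0 : ℝ), K k x * G (ε * x)) - -κ * G ε =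
      ∫ x in Ioi (0 : ℝ), K k x * (G (ε * x) - G ε) := by
    rw [← hKmass k, ← integral_mul_const, ← integral_sub (hKGint k) ((hKint k).integrableOn.mul_const _)]
    refine setIntegral_congr_fun measurableSet_Ioi fun x _ => ?_
    ring
  rw [Real.dist_eq, show -(n : ℝ) / c * G ε = -κ * G ε by rw [hκ, neg_div], hdiff]
  calc |∫ x in Ioi (0 : ℝ), K k x * (G (ε * x) - G ε)|
      ≤ ∫ x in Ioi (0 : ℝ), |K k x * (G (ε * x) - G ε)| := abs_integral_le_integral_abs
    _ ≤ ∫ x in Ioi (0 : ℝ), -K k x * η' := by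
        refine setIntegral_mono_on ?_ (((hKint k).neg.mul_const η').integrableOn) measurableSet_Ioi
          fun x hx => hpt x hx
        exact ((hKGint k).sub ((hKint k).integrableOn.mul_const (G ε))).abs.congr
          (ae_of_all _ fun x => by simp only [Pi.sub_apply]; ring_nf)
    _ = κ * η' := by
        rw [integral_mul_const, integral_neg, hKmass k, neg_neg]
    _ < η := by
        rw [hη']
        field_simp
        linarith

end Unaverage

/-! ## Sphere shears and continuity of translation in `L^p` -/

section Shear



variable (d) in
/-- The **sphere shear** `((t,x),ω) ↦ ((t, x + π(rω)), ω)` of `(ℝ × T^d) × S^{d-1}` at scale `r`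
(`π : ℝ^d → T^d` the covering map), as a continuous family in `r` of continuous self-maps — the
form in which Mathlib's continuity of `(g, f) ↦ g ∘ f` on `L^p × C(X, X)`
(`MeasureTheory.Lp.compMeasurePreserving_continuous`) yields continuity of translation of the
increments `δu(t,x; rω)` in the scale `r`. [folklore] -/
def sphereShear :
    C(ℝ, C((ℝ × UnitAddTorus d) × ↥(sphere (0 : EuclideanSpace ℝ d) 1),
      (ℝ × UnitAddTorus d) × ↥(sphere (0 : EuclideanSpace ℝ d) 1))) :=
  (ContinuousMap.mk (fun z : ℝ × ((ℝ × UnitAddTorus d) × ↥(sphere (0 : EuclideanSpace ℝ d) 1)) =>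
      ((z.2.1.1, z.2.1.2 + FunctionSpaces.Torus.proj (z.1 • (z.2.2 : EuclideanSpace ℝ d))), z.2.2))
    (by
      refine ((continuous_fst.comp (continuous_fst.comp continuous_snd)).prodMk ?_).prodMk
        (continuous_snd.comp continuous_snd)
      exact (continuous_snd.comp (continuous_fst.comp continuous_snd)).add
        (FunctionSpaces.Torus.continuous_proj.comp
          (continuous_fst.smul (continuous_subtype_val.comp (continuous_snd.comp continuous_snd)))))).curry

/-- Unfolding the sphere shear. [folklore] -/
theorem sphereShear_apply (r : ℝ) (y : (ℝ × UnitAddTorus d) × ↥(sphere (0 : EuclideanSpace ℝ d) 1)) :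
    sphereShear d r y = ((y.1.1, y.1.2 + FunctionSpaces.Torus.proj (r • (y.2 : EuclideanSpace ℝ d))), y.2) :=
  rfl

/-- Sphere shears preserve the product measure `(μ ⊗ vol_{T^d}) ⊗ σ` (a skew product of torus
translations over the sphere factor; translation invariance of Haar measure on `T^d`). [folklore] -/
theorem measurePreserving_sphereShear (μ : Measure ℝ) [SFinite μ] (r : ℝ) :
    MeasurePreserving (sphereShear d r)
      ((μ.prod (volume : Measure (UnitAddTorus d))).prod (volume : Measure (EuclideanSpace ℝ d)).toSphere)
      ((μ.prod (volume : Measure (UnitAddTorus d))).prod (volume : Measure (EuclideanSpace ℝ d)).toSphere) := by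
  set σ := (volume : Measure (EuclideanSpace ℝ d)).toSphere
  set μp := μ.prod (volume : Measure (UnitAddTorus d))
  -- the skew product over the sphere factor
  have hg : ∀ ω : ↥(sphere (0 : EuclideanSpace ℝ d) 1), MeasurePreserving
      (fun p : ℝ × UnitAddTorus d => (p.1, p.2 + FunctionSpaces.Torus.proj (r • (ω : EuclideanSpace ℝ d)))) μp μp :=
    fun ω => (MeasurePreserving.id μ).prod (measurePreserving_add_right volume _)
  have hgm : Measurable (uncurry fun (ω : ↥(sphere (0 : EuclideanSpace ℝ d) 1)) (p : ℝ × UnitAddTorus d) =>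
      (p.1, p.2 + FunctionSpaces.Torus.proj (r • (ω : EuclideanSpace ℝ d)))) := by
    refine (measurable_fst.comp measurable_snd).prodMk ?_
    exact (measurable_snd.comp measurable_snd).add
      (FunctionSpaces.Torus.measurable_proj.comp
        ((measurable_subtype_coe.comp measurable_fst).const_smul r))
  have hS : MeasurePreserving (fun q : ↥(sphere (0 : EuclideanSpace ℝ d) 1) × (ℝ × UnitAddTorus d) =>
      (q.1, (q.2.1, q.2.2 + FunctionSpaces.Torus.proj (r • (q.1 : EuclideanSpace ℝ d)))))
      (σ.prod μp) (σ.prod μp) :=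
    (MeasurePreserving.id σ).skew_product hgm (ae_of_all _ fun ω => (hg ω).map_eq)
  have h := (measurePreserving_swap (μ := σ) (ν := μp)).comp (hS.comp (measurePreserving_swap (μ := μp) (ν := σ)))
  convert h using 1
  funext y
  rfl

/-- **Continuity of translation in `L^p` along sphere shears.** For `U ∈ L^p` on
`((0,T) × T^d) × S^{d-1}` (`1 ≤ p < ∞`), `r ↦ U ∘ sphereShear r` is continuous into `L^p`:
`‖U ∘ S_r − U ∘ S_{r₀}‖_p → 0` as `r → r₀` (Mathlib's `Lp.compMeasurePreserving_continuous`). [folklore] -/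
theorem tendsto_eLpNorm_comp_sphereShear_sub {T : ℝ} {F : Type*} [NormedAddCommGroup F]
    {U : (ℝ × UnitAddTorus d) × ↥(sphere (0 : EuclideanSpace ℝ d) 1) → F} {p : ℝ≥0∞}
    (hp : 1 ≤ p) (hp' : p ≠ ∞)
    (hU : MemLp U p ((((volume : Measure ℝ).restrict (Ioo 0 T)).prod (volume : Measure (UnitAddTorus d))).prod
      (volume : Measure (EuclideanSpace ℝ d)).toSphere)) (r₀ : ℝ) :
    Tendsto (fun r => eLpNorm (fun y => U (sphereShear d r y) - U (sphereShear d r₀ y)) p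
      ((((volume : Measure ℝ).restrict (Ioo 0 T)).prod (volume : Measure (UnitAddTorus d))).prod
        (volume : Measure (EuclideanSpace ℝ d)).toSphere)) (𝓝 r₀) (𝓝 0) := by
  set ν := (((volume : Measure ℝ).restrict (Ioo 0 T)).prod (volume : Measure (UnitAddTorus d))).prod
        (volume : Measure (EuclideanSpace ℝ d)).toSphere with hν
  haveI : Fact (1 ≤ p) := ⟨hp⟩
  haveI : ν.InnerRegularCompactLTTop := instInnerRegularCompactLTTopOfIsCompletelyPseudoMetrizableSpace _
  have hT : ∀ r, MeasurePreserving (sphereShear d r) ν ν := fun r =>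
    measurePreserving_sphereShear _ r
  have h := Filter.Tendsto.compMeasurePreservingLp (μ := ν) (ν := ν) (E := F) (p := p)
    (tendsto_const_nhds : Tendsto (fun _ : ℝ => hU.toLp U) (𝓝 r₀) (𝓝 (hU.toLp U)))
    ((sphereShear d).continuous.tendsto r₀) hT (hT r₀) hp'
  rw [tendsto_iff_edist_tendsto_0] at h
  refine h.congr fun r => ?_
  rw [Lp.edist_def]
  refine eLpNorm_congr_ae ?_
  have hr : ((hU.toLp U : _ → F) ∘ ⇑(sphereShear d r)) =ᵐ[ν] (U ∘ ⇑(sphereShear d r)) :=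
    (hT r).quasiMeasurePreserving.ae_eq_comp hU.coeFn_toLp
  have h0 : ((hU.toLp U : _ → F) ∘ ⇑(sphereShear d r₀)) =ᵐ[ν] (U ∘ ⇑(sphereShear d r₀)) :=
    (hT r₀).quasiMeasurePreserving.ae_eq_comp hU.coeFn_toLp
  filter_upwards [Lp.coeFn_compMeasurePreserving (hU.toLp U) (hT r),
    Lp.coeFn_compMeasurePreserving (hU.toLp U) (hT r₀), hr, h0] with y hy hy0 hy' hy0'
  rw [Pi.sub_apply, hy, hy0, hy', hy0']
  rfl


end Shear

/-! ## A Hölder inequality for cubic differences -/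

section Holder


/-- `(a + b)³ ≤ 4 (a³ + b³)` in `ℝ≥0∞`. [folklore] -/
theorem ennreal_add_pow_three_le (a b : ℝ≥0∞) : (a + b) ^ 3 ≤ 4 * (a ^ 3 + b ^ 3) := by
  have h := ENNReal.rpow_add_le_mul_rpow_add_rpow a b (p := 3) (by norm_num)
  have h2 : (2 : ℝ≥0∞) ^ ((3 : ℝ) - 1) = 4 := by
    rw [show (3 : ℝ) - 1 = 2 by norm_num, ENNReal.rpow_two]; norm_num
  have h3 : ∀ x : ℝ≥0∞, x ^ (3 : ℝ) = x ^ 3 := fun x => by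
    rw [show (3 : ℝ) = ((3 : ℕ) : ℝ) by norm_num, ENNReal.rpow_natCast]
  simpa only [h2, h3] using h

/-- **Hölder `3, 3/2` for cubic differences**: for measurable `f, a, b ≥ 0`,
`∫⁻ f (a + b)² ≤ (∫⁻ f³)^{1/3} (4 (∫⁻ a³ + ∫⁻ b³))^{2/3}`. [folklore] -/
theorem lintegral_mul_add_sq_le {α : Type*} [MeasurableSpace α] (μ : Measure α) {f a b : α → ℝ≥0∞}
    (hf : AEMeasurable f μ) (ha : AEMeasurable a μ) (hb : AEMeasurable b μ) :
    ∫⁻ x, f x * (a x + b x) ^ 2 ∂μ ≤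
      (∫⁻ x, f x ^ 3 ∂μ) ^ (1 / 3 : ℝ) * (4 * (∫⁻ x, a x ^ 3 ∂μ + ∫⁻ x, b x ^ 3 ∂μ)) ^ (2 / 3 : ℝ) := by
  have hpq : Real.HolderConjugate 3 (3 / 2) := Real.holderConjugate_iff.2 ⟨by norm_num, by norm_num⟩
  have hg2 : AEMeasurable (fun x => (a x + b x) ^ 2) μ := (ha.add hb).pow_const 2
  have h := ENNReal.lintegral_mul_le_Lp_mul_Lq μ hpq (f := f) (g := fun x => (a x + b x) ^ 2) hf hg2
  have h3 : ∀ x : ℝ≥0∞, x ^ (3 : ℝ) = x ^ 3 := fun x => by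
    rw [show (3 : ℝ) = ((3 : ℕ) : ℝ) by norm_num, ENNReal.rpow_natCast]
  have hg : ∀ x, ((a x + b x) ^ 2) ^ (3 / 2 : ℝ) = (a x + b x) ^ 3 := fun x => by
    rw [← ENNReal.rpow_two, ← ENNReal.rpow_mul, show (2 : ℝ) * (3 / 2) = 3 by norm_num, h3]
  simp only [Pi.mul_apply, h3, hg, one_div, show ((3 : ℝ) / 2)⁻¹ = 2 / 3 by norm_num] at h
  refine h.trans ?_
  rw [show (1 / 3 : ℝ) = (3 : ℝ)⁻¹ by norm_num]
  gcongr
  calc ∫⁻ x, (a x + b x) ^ 3 ∂μ ≤ ∫⁻ x, 4 * (a x ^ 3 + b x ^ 3) ∂μ :=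
        lintegral_mono fun x => ennreal_add_pow_three_le _ _
    _ = 4 * (∫⁻ x, a x ^ 3 ∂μ + ∫⁻ x, b x ^ 3 ∂μ) := by
        rw [lintegral_const_mul' _ _ (by norm_num), lintegral_add_left' (ha.pow_const 3)]


end Holder

/-! ## The shell pairing and its continuity in the scale -/

section ShellPairing

variable {T : ℝ} {u : ℝ → UnitAddTorus d → EuclideanSpace ℝ d} {ψ : ℝ → UnitAddTorus d → ℝ} {Cψ : ℝ}

variable (T u) in
/-- The **shell pairing** `I(r) = ∫_{(0,T) × T^d} ⨍_{S^{d-1}} (δu(t,x; rω)·ω) |δu(t,x; rω)|² dω ψ(t,x)`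
(product-measure form) of the sphere-averaged energy flux `Torus.energyFluxSphereAvg` with a test
function; the 4/3-law quantity is `r⁻¹ I(r)` (`integral_inv_mul_energyFluxSphereAvg_eq`). [folklore] -/
def energyFluxShellPairing (ψ : ℝ → UnitAddTorus d → ℝ) (r : ℝ) : ℝ :=
  ∫ p, energyFluxSphereAvg (u p.1) r p.2 * ψ p.1 p.2 ∂((volume.restrict (Ioo 0 T)).prod volume)

/-- The cubic form of the 4/3 law is Lipschitz on bounded sets, cubically:
`|⟪v,ω⟫|v|² − ⟪w,ω⟫|w|²| ≤ |v − w| (|v| + |w|)²` for `|ω| ≤ 1`. [folklore] -/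
theorem abs_inner_mul_norm_sq_sub_le {E : Type*} [NormedAddCommGroup E] [InnerProductSpace ℝ E]
    (ω v w : E) (hω : ‖ω‖ ≤ 1) :
    |⟪v, ω⟫ * ‖v‖ ^ 2 - ⟪w, ω⟫ * ‖w‖ ^ 2| ≤ ‖v - w‖ * (‖v‖ + ‖w‖) ^ 2 := by
  have h1 : ⟪v, ω⟫ * ‖v‖ ^ 2 - ⟪w, ω⟫ * ‖w‖ ^ 2 =
      ⟪v - w, ω⟫ * ‖v‖ ^ 2 + ⟪w, ω⟫ * (‖v‖ ^ 2 - ‖w‖ ^ 2) := by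
    rw [inner_sub_left]; ring
  rw [h1]
  have ha : |⟪v - w, ω⟫ * ‖v‖ ^ 2| ≤ ‖v - w‖ * ‖v‖ ^ 2 := by
    rw [abs_mul, abs_of_nonneg (pow_nonneg (norm_nonneg v) 2)]
    gcongr
    calc |⟪v - w, ω⟫| ≤ ‖v - w‖ * ‖ω‖ := abs_real_inner_le_norm _ _
      _ ≤ ‖v - w‖ * 1 := by gcongr
      _ = ‖v - w‖ := mul_one _
  have hb : |⟪w, ω⟫ * (‖v‖ ^ 2 - ‖w‖ ^ 2)| ≤ ‖w‖ * (‖v - w‖ * (‖v‖ + ‖w‖)) := by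
    rw [abs_mul]
    gcongr
    · calc |⟪w, ω⟫| ≤ ‖w‖ * ‖ω‖ := abs_real_inner_le_norm _ _
        _ ≤ ‖w‖ * 1 := by gcongr
        _ = ‖w‖ := mul_one _
    · rw [sq_sub_sq, abs_mul, abs_of_nonneg (add_nonneg (norm_nonneg v) (norm_nonneg w)), mul_comm]
      gcongr
      exact abs_norm_sub_norm_le v w
  calc |⟪v - w, ω⟫ * ‖v‖ ^ 2 + ⟪w, ω⟫ * (‖v‖ ^ 2 - ‖w‖ ^ 2)|
      ≤ |⟪v - w, ω⟫ * ‖v‖ ^ 2| + |⟪w, ω⟫ * (‖v‖ ^ 2 - ‖w‖ ^ 2)| := abs_add_le _ _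
    _ ≤ ‖v - w‖ * ‖v‖ ^ 2 + ‖w‖ * (‖v - w‖ * (‖v‖ + ‖w‖)) := add_le_add ha hb
    _ ≤ ‖v - w‖ * (‖v‖ + ‖w‖) ^ 2 := by
        nlinarith [norm_nonneg (v - w), norm_nonneg v, norm_nonneg w,
          mul_nonneg (norm_nonneg (v - w)) (mul_nonneg (norm_nonneg v) (norm_nonneg w)),
          mul_nonneg (norm_nonneg (v - w)) (sq_nonneg ‖w‖)]

/-- `eLpNorm f 3 = (∫⁻ ‖f‖ₑ³)^{1/3}`. [folklore] -/
theorem eLpNorm_three_eq {α F : Type*} [MeasurableSpace α] [NormedAddCommGroup F] (μ : Measure α) (f : α → F) :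
    eLpNorm f 3 μ = (∫⁻ x, ‖f x‖ₑ ^ 3 ∂μ) ^ (1 / 3 : ℝ) := by
  rw [eLpNorm_eq_lintegral_rpow_enorm_toReal (by norm_num) (by norm_num)]
  have h3 : (3 : ℝ≥0∞).toReal = ((3 : ℕ) : ℝ) := by norm_num
  simp only [h3, ENNReal.rpow_natCast]
  norm_num

/-- **Continuity of the shell pairing in the scale** for `u ∈ L³((0,T) × T^d)` and bounded
measurable `ψ`: `r ↦ I(r)` is continuous on `ℝ`. The increments at scales `r` and `r₀` differ by
`u(t, x + π(rω)) − u(t, x + π(r₀ω))`, which is small in `L³(((0,T) × T^d) × S^{d-1})` as `r → r₀`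
(continuity of translation, `tendsto_eLpNorm_comp_sphereShear_sub`); the cubic form is controlled
by Hölder `3, 3/2` (`lintegral_mul_add_sq_le`). [folklore] -/
theorem continuous_shellPairing [Nonempty d]
    (hu : AEStronglyMeasurable (uncurry u) ((volume.restrict (Ioo 0 T)).prod volume))
    (hu3 : ∫⁻ p, ‖uncurry u p‖ₑ ^ 3 ∂((volume.restrict (Ioo 0 T)).prod volume) < ∞)
    (hψm : AEStronglyMeasurable (uncurry ψ) ((volume.restrict (Ioo 0 T)).prod volume))
    (hψb : ∀ t x, |ψ t x| ≤ Cψ) :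
    Continuous (energyFluxShellPairing T u ψ) := by
  set μp : Measure (ℝ × UnitAddTorus d) := (volume.restrict (Ioo 0 T)).prod volume with hμp
  set σ : Measure ↥(sphere (0 : EuclideanSpace ℝ d) 1) := volume.toSphere with hσ
  set ν := μp.prod σ with hν
  have hCψ : 0 ≤ Cψ := (abs_nonneg _).trans (hψb 0 0)
  set c : ℝ := (volume : Measure (EuclideanSpace ℝ d)).toSphere.real univ with hcdef
  have hc : 0 < c := toSphere_real_univ_pos
  -- the cubic form
  set Q : EuclideanSpace ℝ d → EuclideanSpace ℝ d → ℝ := fun ω v => ⟪v, ω⟫ * ‖v‖ ^ 2 with hQdef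
  have hQc : Continuous (uncurry Q) :=
    (continuous_snd.inner continuous_fst).mul (continuous_snd.norm.pow 2)
  have hQ : ∀ ω v, ‖ω‖ ≤ 1 → |Q ω v| ≤ 1 * ‖v‖ ^ 3 := fun ω v hω => by
    rw [one_mul, hQdef, abs_mul, abs_of_nonneg (pow_nonneg (norm_nonneg v) 2)]
    calc |⟪v, ω⟫| * ‖v‖ ^ 2 ≤ ‖v‖ * ‖ω‖ * ‖v‖ ^ 2 := by
          gcongr; exact abs_real_inner_le_norm v ω
      _ ≤ ‖v‖ * 1 * ‖v‖ ^ 2 := by gcongr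
      _ = ‖v‖ ^ 3 := by ring
  -- the integrand on `((0,T) × T^d) × S^{d-1}` and its integrability
  set W : ℝ → (ℝ × UnitAddTorus d) × ↥(sphere (0 : EuclideanSpace ℝ d) 1) → ℝ := fun r y =>
    Q y.2 (increment (u y.1.1) (r • (y.2 : EuclideanSpace ℝ d)) y.1.2) * ψ y.1.1 y.1.2 with hW
  have hWi : ∀ r, Integrable (W r) ν := fun r =>
    integrable_sphere_increment hu hu3 hψm hψb hQc zero_le_one hQ r
  -- the shell pairing is `c⁻¹ ∫ W r`
  have hid : ∀ r, energyFluxShellPairing T u ψ r = c⁻¹ * ∫ y, W r y ∂ν := by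
    intro r
    rw [energyFluxShellPairing, ← hμp, integral_prod _ (hWi r)]
    have h4 : ∀ p : ℝ × UnitAddTorus d,
        ∫ ω : sphere (0 : EuclideanSpace ℝ d) 1,
            Q ω (increment (u p.1) (r • (ω : EuclideanSpace ℝ d)) p.2) * ψ p.1 p.2 ∂σ =
          c * (energyFluxSphereAvg (u p.1) r p.2 * ψ p.1 p.2) := fun p => by
      rw [integral_mul_const,
        integral_sphere_eq_mul_sphereAvg (fun y => Q y (increment (u p.1) (r • y) p.2)), mul_assoc]
      rfl
    rw [integral_congr_ae (ae_of_all _ h4), integral_const_mul, ← mul_assoc, inv_mul_cancel₀ hc.ne',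
      one_mul]
  -- reduce to continuity of `r ↦ ∫ W r` in `L¹`
  suffices hcont : ∀ r₀, Tendsto (fun r => ∫ y, W r y ∂ν) (𝓝 r₀) (𝓝 (∫ y, W r₀ y ∂ν)) by
    have heq : energyFluxShellPairing T u ψ = fun r => c⁻¹ * ∫ y, W r y ∂ν := funext hid
    rw [heq]
    exact continuous_iff_continuousAt.2 fun r₀ => (hcont r₀).const_mul c⁻¹
  intro r₀
  refine tendsto_integral_of_L1 (W r₀) (hWi r₀).aestronglyMeasurable (Eventually.of_forall hWi) ?_
  -- the unshifted field on the triple product and its cube integrability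
  set U : (ℝ × UnitAddTorus d) × ↥(sphere (0 : EuclideanSpace ℝ d) 1) → EuclideanSpace ℝ d :=
    fun y => u y.1.1 y.1.2 with hUdef
  have hUm : AEStronglyMeasurable U ν := hu.comp_fst
  set L : ℝ≥0∞ := ∫⁻ p, ‖uncurry u p‖ₑ ^ 3 ∂μp with hL
  have hshift3 : ∀ r, ∫⁻ y, ‖U (sphereShear d r y)‖ₑ ^ 3 ∂ν = σ univ * L := by
    intro r
    have ha : Measurable fun ω : sphere (0 : EuclideanSpace ℝ d) 1 =>
        FunctionSpaces.Torus.proj (r • (ω : EuclideanSpace ℝ d)) :=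
      FunctionSpaces.Torus.measurable_proj.comp (continuous_subtype_val.const_smul r).measurable
    have := lintegral_mul_translate_enorm_pow (ν := σ) hu ha (w := fun _ => 1) aemeasurable_const 3
    simp only [one_mul, lintegral_const] at this
    exact this
  have hU3 : ∫⁻ y, ‖U y‖ₑ ^ 3 ∂ν = σ univ * L := by
    have := hshift3 0
    simp only [sphereShear_apply, zero_smul, FunctionSpaces.Torus.proj_zero, add_zero] at this
    exact this
  have hσfin : σ univ < ∞ := measure_lt_top _ _
  have hLfin : σ univ * L < ∞ := ENNReal.mul_lt_top hσfin hu3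
  have hUp : MemLp U 3 ν := by
    refine ⟨hUm, ?_⟩
    rw [eLpNorm_three_eq, hU3]
    exact ENNReal.rpow_lt_top_of_nonneg (by norm_num) hLfin.ne
  -- continuity of translation
  have hT := tendsto_eLpNorm_comp_sphereShear_sub (T := T) (by norm_num) (by norm_num) hUp r₀
  -- cube bounds for the increments
  set δ : ℝ → (ℝ × UnitAddTorus d) × ↥(sphere (0 : EuclideanSpace ℝ d) 1) → EuclideanSpace ℝ d :=
    fun r y => increment (u y.1.1) (r • (y.2 : EuclideanSpace ℝ d)) y.1.2 with hδdef
  have hδeq : ∀ r y, δ r y = U (sphereShear d r y) - U y := fun r y => rfl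
  have hδm : ∀ r, AEStronglyMeasurable (δ r) ν := fun r => aestronglyMeasurable_increment_sphere hu r
  have hδ3 : ∀ r, ∫⁻ y, ‖δ r y‖ₑ ^ 3 ∂ν ≤ 4 * (σ univ * L + σ univ * L) := by
    intro r
    calc ∫⁻ y, ‖δ r y‖ₑ ^ 3 ∂ν ≤ ∫⁻ y, 4 * (‖U (sphereShear d r y)‖ₑ ^ 3 + ‖U y‖ₑ ^ 3) ∂ν := by
          refine lintegral_mono fun y => ?_
          rw [hδeq]
          exact (pow_le_pow_left' (enorm_sub_le (E := EuclideanSpace ℝ d)) 3).trans (ennreal_add_pow_three_le _ _)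
      _ = 4 * (σ univ * L + σ univ * L) := by
          rw [lintegral_const_mul' _ _ (by norm_num), lintegral_add_left' ?_, hshift3 r, hU3]
          exact ((hUm.comp_measurePreserving (measurePreserving_sphereShear _ r)).enorm.pow_const 3)
  set M : ℝ≥0∞ := 4 * (4 * (σ univ * L + σ univ * L) + 4 * (σ univ * L + σ univ * L)) with hM
  have hMfin : M ≠ ∞ := by
    have h8 : 4 * (σ univ * L + σ univ * L) ≠ ∞ :=
      ENNReal.mul_ne_top (by norm_num) (ENNReal.add_ne_top.2 ⟨hLfin.ne, hLfin.ne⟩)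
    exact ENNReal.mul_ne_top (by norm_num) (ENNReal.add_ne_top.2 ⟨h8, h8⟩)
  -- pointwise bound on the difference of the integrands
  have hpt : ∀ r y, ‖W r y - W r₀ y‖ₑ ≤
      ENNReal.ofReal Cψ * (‖U (sphereShear d r y) - U (sphereShear d r₀ y)‖ₑ * (‖δ r y‖ₑ + ‖δ r₀ y‖ₑ) ^ 2) := by
    intro r y
    have hω : ‖(y.2 : EuclideanSpace ℝ d)‖ ≤ 1 := (norm_eq_of_mem_sphere y.2).le
    have hreal : |W r y - W r₀ y| ≤ Cψ * (‖δ r y - δ r₀ y‖ * (‖δ r y‖ + ‖δ r₀ y‖) ^ 2) := by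
      have : W r y - W r₀ y = (Q y.2 (δ r y) - Q y.2 (δ r₀ y)) * ψ y.1.1 y.1.2 := by
        simp only [hW, hδdef]; ring
      rw [this, abs_mul, mul_comm Cψ]
      exact mul_le_mul (abs_inner_mul_norm_sq_sub_le _ _ _ hω) (hψb _ _) (abs_nonneg _)
        (by positivity)
    have hsub : δ r y - δ r₀ y = U (sphereShear d r y) - U (sphereShear d r₀ y) := by
      rw [hδeq, hδeq]; abel
    rw [Real.enorm_eq_ofReal_abs]
    refine (ENNReal.ofReal_le_ofReal hreal).trans (le_of_eq ?_)
    rw [ENNReal.ofReal_mul hCψ, ENNReal.ofReal_mul (norm_nonneg _), ENNReal.ofReal_pow (by positivity),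
      ENNReal.ofReal_add (norm_nonneg _) (norm_nonneg _), ofReal_norm, ofReal_norm,
      ofReal_norm, hsub]
  -- integrate the bound: Hölder
  have hbound : ∀ r, ∫⁻ y, ‖W r y - W r₀ y‖ₑ ∂ν ≤
      ENNReal.ofReal Cψ * (eLpNorm (fun y => U (sphereShear d r y) - U (sphereShear d r₀ y)) 3 ν *
        M ^ (2 / 3 : ℝ)) := by
    intro r
    have hfm : AEMeasurable (fun y => ‖U (sphereShear d r y) - U (sphereShear d r₀ y)‖ₑ) ν :=
      ((hUm.comp_measurePreserving (measurePreserving_sphereShear _ r)).sub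
        (hUm.comp_measurePreserving (measurePreserving_sphereShear _ r₀))).enorm
    calc ∫⁻ y, ‖W r y - W r₀ y‖ₑ ∂ν
        ≤ ∫⁻ y, ENNReal.ofReal Cψ * (‖U (sphereShear d r y) - U (sphereShear d r₀ y)‖ₑ *
            (‖δ r y‖ₑ + ‖δ r₀ y‖ₑ) ^ 2) ∂ν := lintegral_mono (hpt r)
      _ = ENNReal.ofReal Cψ * ∫⁻ y, ‖U (sphereShear d r y) - U (sphereShear d r₀ y)‖ₑ *
            (‖δ r y‖ₑ + ‖δ r₀ y‖ₑ) ^ 2 ∂ν := lintegral_const_mul' _ _ ENNReal.ofReal_ne_top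
      _ ≤ ENNReal.ofReal Cψ * ((∫⁻ y, ‖U (sphereShear d r y) - U (sphereShear d r₀ y)‖ₑ ^ 3 ∂ν) ^ (1 / 3 : ℝ) *
            (4 * (∫⁻ y, ‖δ r y‖ₑ ^ 3 ∂ν + ∫⁻ y, ‖δ r₀ y‖ₑ ^ 3 ∂ν)) ^ (2 / 3 : ℝ)) := by
          gcongr
          exact lintegral_mul_add_sq_le ν hfm (hδm r).enorm (hδm r₀).enorm
      _ ≤ ENNReal.ofReal Cψ * (eLpNorm (fun y => U (sphereShear d r y) - U (sphereShear d r₀ y)) 3 ν *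
            M ^ (2 / 3 : ℝ)) := by
          rw [eLpNorm_three_eq]
          gcongr ENNReal.ofReal Cψ * (_ * ?_ ^ (2 / 3 : ℝ))
          rw [hM]
          gcongr
          · exact hδ3 r
          · exact hδ3 r₀
  -- squeeze
  have hlim : Tendsto (fun r => ENNReal.ofReal Cψ *
      (eLpNorm (fun y => U (sphereShear d r y) - U (sphereShear d r₀ y)) 3 ν * M ^ (2 / 3 : ℝ)))
      (𝓝 r₀) (𝓝 0) := by
    have h1 := ENNReal.Tendsto.mul_const hT (Or.inr (ENNReal.rpow_ne_top_of_nonneg (y := (2 / 3 : ℝ)) (by norm_num) hMfin))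
    rw [zero_mul] at h1
    have h2 := ENNReal.Tendsto.const_mul h1 (Or.inr ENNReal.ofReal_ne_top) (a := ENNReal.ofReal Cψ)
    rwa [mul_zero] at h2
  exact tendsto_of_tendsto_of_tendsto_of_le_of_le tendsto_const_nhds hlim (fun r => bot_le) hbound

end ShellPairing

/-! ## The Duchon–Robert pairing of a radial mollifier through the shell pairing -/

section RadialFormula

variable {T : ℝ} {u : ℝ → UnitAddTorus d → EuclideanSpace ℝ d} {ψ : ℝ → UnitAddTorus d → ℝ} {Cψ : ℝ}

/-- The iterated 4/3-law pairing is `ℓ⁻¹ I(ℓ)` with the product-form shell pairing `I`. [folklore] -/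
theorem integral_inv_mul_energyFluxSphereAvg_eq [Nonempty d]
    (hu : AEStronglyMeasurable (uncurry u) ((volume.restrict (Ioo 0 T)).prod volume))
    (hu3 : ∫⁻ p, ‖uncurry u p‖ₑ ^ 3 ∂((volume.restrict (Ioo 0 T)).prod volume) < ∞)
    (hψm : AEStronglyMeasurable (uncurry ψ) ((volume.restrict (Ioo 0 T)).prod volume))
    (hψb : ∀ t x, |ψ t x| ≤ Cψ) (ℓ : ℝ) :
    ∫ t in Ioo 0 T, ∫ x, ℓ⁻¹ * energyFluxSphereAvg (u t) ℓ x * ψ t x = ℓ⁻¹ * energyFluxShellPairing T u ψ ℓ := by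
  set μp : Measure (ℝ × UnitAddTorus d) := (volume.restrict (Ioo 0 T)).prod volume with hμp
  set c : ℝ := (volume : Measure (EuclideanSpace ℝ d)).toSphere.real univ with hcdef
  have hc : 0 < c := toSphere_real_univ_pos
  set Q : EuclideanSpace ℝ d → EuclideanSpace ℝ d → ℝ := fun ω v => ⟪v, ω⟫ * ‖v‖ ^ 2 with hQdef
  have hQc : Continuous (uncurry Q) :=
    (continuous_snd.inner continuous_fst).mul (continuous_snd.norm.pow 2)
  have hQ : ∀ ω v, ‖ω‖ ≤ 1 → |Q ω v| ≤ 1 * ‖v‖ ^ 3 := fun ω v hω => by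
    rw [one_mul, hQdef, abs_mul, abs_of_nonneg (pow_nonneg (norm_nonneg v) 2)]
    calc |⟪v, ω⟫| * ‖v‖ ^ 2 ≤ ‖v‖ * ‖ω‖ * ‖v‖ ^ 2 := by
          gcongr; exact abs_real_inner_le_norm v ω
      _ ≤ ‖v‖ * 1 * ‖v‖ ^ 2 := by gcongr
      _ = ‖v‖ ^ 3 := by ring
  have hS' := integrable_sphere_increment hu hu3 hψm hψb hQc zero_le_one hQ ℓ
  have hint : Integrable (fun p : ℝ × UnitAddTorus d =>
      energyFluxSphereAvg (u p.1) ℓ p.2 * ψ p.1 p.2) μp := by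
    have h1 := hS'.integral_prod_left
    have h2 : ∀ p : ℝ × UnitAddTorus d,
        ∫ ω : sphere (0 : EuclideanSpace ℝ d) 1,
            Q ω (increment (u p.1) (ℓ • (ω : EuclideanSpace ℝ d)) p.2) * ψ p.1 p.2 ∂volume.toSphere =
          c * (energyFluxSphereAvg (u p.1) ℓ p.2 * ψ p.1 p.2) := fun p => by
      rw [integral_mul_const,
        integral_sphere_eq_mul_sphereAvg (fun y => Q y (increment (u p.1) (ℓ • y) p.2)), mul_assoc]
      rfl
    refine ((h1.congr (ae_of_all _ h2)).const_mul c⁻¹).congr (ae_of_all _ fun p => ?_)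
    simp only
    rw [← mul_assoc, inv_mul_cancel₀ hc.ne', one_mul]
  have e1 : ∫ t in Ioo 0 T, ∫ x, ℓ⁻¹ * (energyFluxSphereAvg (u t) ℓ x * ψ t x) =
      ∫ p, ℓ⁻¹ * (energyFluxSphereAvg (u p.1) ℓ p.2 * ψ p.1 p.2) ∂μp :=
    (integral_prod _ (hint.const_mul ℓ⁻¹)).symm
  simp only [energyFluxShellPairing, mul_assoc]
  rw [e1, integral_const_mul]

/-- **The Duchon–Robert pairing of a radial unit-ball mollifier is a rescaled average of shell
pairings** (Duchon–Robert 2000, §5; Eyink 2003, proof of Cor. 1: Fubini and polar coordinates):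
for `ε > 0`,
`∫₀ᵀ∫ D_ε^φ(u) ψ = ¼ |S^{d-1}| ∫_{x>0} x^d Φ'(x) · (εx)⁻¹ I(εx) dx`
with the profile `Φ(r) = φ(r e₀)` and the shell pairing `I = energyFluxShellPairing T u ψ`. (The identity
"Step A" inside `HasDuchonRobertDefect.eq_of_tendsto_energyFlux`, made available as a lemma.)
[cite: Eyink2003, §2 proof of Cor. 1] -/
theorem integral_duchonRobertApprox_eq_radial [Nonempty d] {φ : EuclideanSpace ℝ d → ℝ}
    (hφ : IsUnitBallMollifier φ) (hrad : ∀ x y, ‖x‖ = ‖y‖ → φ x = φ y)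
    {e₀ : EuclideanSpace ℝ d} (he₀ : ‖e₀‖ = 1)
    (hu : AEStronglyMeasurable (uncurry u) ((volume.restrict (Ioo 0 T)).prod volume))
    (hu3 : ∫⁻ p, ‖uncurry u p‖ₑ ^ 3 ∂((volume.restrict (Ioo 0 T)).prod volume) < ∞)
    (hψm : AEStronglyMeasurable (uncurry ψ) ((volume.restrict (Ioo 0 T)).prod volume))
    (hψb : ∀ t x, |ψ t x| ≤ Cψ) {ε : ℝ} (hε : 0 < ε) :
    ∫ t in Ioo 0 T, ∫ x, duchonRobertApprox φ ε (u t) x * ψ t x =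
      4⁻¹ * (volume : Measure (EuclideanSpace ℝ d)).toSphere.real univ *
        ∫ x in Ioi (0 : ℝ), x ^ Fintype.card d * deriv (fun r : ℝ => φ (r • e₀)) x *
          ((ε * x)⁻¹ * energyFluxShellPairing T u ψ (ε * x)) := by
  set μp : Measure (ℝ × UnitAddTorus d) := (volume.restrict (Ioo 0 T)).prod volume with hμp
  -- the cubic form of the 4/3 law
  set Q : EuclideanSpace ℝ d → EuclideanSpace ℝ d → ℝ := fun ω v => ⟪v, ω⟫ * ‖v‖ ^ 2 with hQdef
  have hQc : Continuous (uncurry Q) :=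
    (continuous_snd.inner continuous_fst).mul (continuous_snd.norm.pow 2)
  have hQ : ∀ ω v, ‖ω‖ ≤ 1 → |Q ω v| ≤ 1 * ‖v‖ ^ 3 := fun ω v hω => by
    rw [one_mul, hQdef, abs_mul, abs_of_nonneg (pow_nonneg (norm_nonneg v) 2)]
    calc |⟪v, ω⟫| * ‖v‖ ^ 2 ≤ ‖v‖ * ‖ω‖ * ‖v‖ ^ 2 := by
          gcongr; exact abs_real_inner_le_norm v ω
      _ ≤ ‖v‖ * 1 * ‖v‖ ^ 2 := by gcongr
      _ = ‖v‖ ^ 3 := by ring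
  -- the profile and the surface area
  set Φ : ℝ → ℝ := fun r => φ (r • e₀) with hΦ
  have hφs := hφ.1.1
  have hφsupp := hφ.2
  have hΦsupp : ∀ r, 1 < r → Φ r = 0 := fun r hr =>
    hφsupp _ (by rw [norm_smul, he₀, mul_one, Real.norm_eq_abs]; exact hr.trans_le (le_abs_self r))
  have hΦ'supp : ∀ r, 1 < r → deriv Φ r = 0 := fun r hr => deriv_eq_zero_of_forall_gt hΦsupp hr
  have hΦsmooth : ContDiff ℝ 1 Φ := (hφs.of_le (by simp)).comp (contDiff_id.smul contDiff_const)
  have hΦ'c : Continuous (deriv Φ) := hΦsmooth.continuous_deriv le_rfl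
  set n : ℕ := Fintype.card d with hndef
  have hn : 1 ≤ n := Fintype.card_pos
  set c : ℝ := (volume : Measure (EuclideanSpace ℝ d)).toSphere.real univ with hcdef
  set I : ℝ → ℝ := energyFluxShellPairing T u ψ with hI
  -- the rescaled kernel `k_ε(r) = ε^{-d} ε⁻¹ Φ'(r/ε)`
  set kε : ℝ → ℝ := fun r => (ε ^ n)⁻¹ * (ε⁻¹ * deriv Φ (ε⁻¹ * r)) with hkε
  have hkcont : Continuous kε :=
    continuous_const.mul (continuous_const.mul (hΦ'c.comp (continuous_const.mul continuous_id)))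
  have hksupp : ∀ r, ε < r → kε r = 0 := fun r hr => by
    simp only [hkε]
    rw [hΦ'supp _ (by rw [← div_eq_inv_mul, one_lt_div hε]; exact hr), mul_zero, mul_zero]
  have hkint : Integrable (fun ξ : EuclideanSpace ℝ d => kε ‖ξ‖) volume := by
    refine (hkcont.comp continuous_norm).integrable_of_hasCompactSupport ?_
    refine HasCompactSupport.intro (isCompact_closedBall (0 : EuclideanSpace ℝ d) ε) fun ξ hξ => ?_
    exact hksupp ‖ξ‖ (by simpa [dist_zero_right] using hξ)
  -- (A1) the flux in kernel form
  have hDR : ∀ (t : ℝ) (x : UnitAddTorus d), duchonRobertApprox φ ε (u t) x =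
      4⁻¹ * ∫ ξ, kε ‖ξ‖ * Q (‖ξ‖⁻¹ • ξ) (increment (u t) ξ x) := by
    intro t x
    rw [duchonRobertApprox]
    congr 1
    refine integral_congr_ae (ae_of_all _ fun ξ => ?_)
    exact dr_integrand_eq_kernel hφs hrad he₀ ε (u t) x ξ
  -- (A2) iterated pairing = product pairing
  have hF := integrable_kernel_increment hu hu3 hψm hψb hQc zero_le_one hQ hkint
  have hmarg : Integrable (fun p : ℝ × UnitAddTorus d =>
      (∫ ξ, kε ‖ξ‖ * Q (‖ξ‖⁻¹ • ξ) (increment (u p.1) ξ p.2)) * ψ p.1 p.2) μp := by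
    refine hF.integral_prod_left.congr (ae_of_all _ fun p => ?_)
    simp only
    rw [← integral_mul_const]
  have hpt : (fun t => ∫ x, duchonRobertApprox φ ε (u t) x * ψ t x) = fun t =>
      4⁻¹ * ∫ x, (∫ ξ, kε ‖ξ‖ * Q (‖ξ‖⁻¹ • ξ) (increment (u t) ξ x)) * ψ t x := by
    funext t
    rw [← integral_const_mul]
    refine integral_congr_ae (ae_of_all _ fun x => ?_)
    simp only
    rw [hDR t x, mul_assoc]
  have e1 : ∫ t in Ioo 0 T, ∫ x, (∫ ξ, kε ‖ξ‖ * Q (‖ξ‖⁻¹ • ξ) (increment (u t) ξ x)) * ψ t x =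
      ∫ p, (∫ ξ, kε ‖ξ‖ * Q (‖ξ‖⁻¹ • ξ) (increment (u p.1) ξ p.2)) * ψ p.1 p.2 ∂μp :=
    (integral_prod _ hmarg).symm
  rw [hpt, integral_const_mul, e1,
    integral_kernel_increment_eq_polar hu hu3 hψm hψb hQc zero_le_one hQ hkint]
  -- (A3) the substitution `r = ε x`
  have hsub := integral_comp_mul_left_Ioi (fun r => r ^ (n - 1) * kε r * I r) 0 hε
  rw [mul_zero] at hsub
  have e2 : ∫ r in Ioi (0 : ℝ), r ^ (n - 1) * kε r * I r =
      ε * ∫ x in Ioi (0 : ℝ), (ε * x) ^ (n - 1) * kε (ε * x) * I (ε * x) := by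
    rw [hsub, smul_eq_mul, ← mul_assoc, mul_inv_cancel₀ hε.ne', one_mul]
  have e3 : ∫ r in Ioi (0 : ℝ), r ^ (Fintype.card d - 1) * kε r *
        ∫ p, sphereAvg (fun y => Q y (increment (u p.1) (r • y) p.2)) * ψ p.1 p.2 ∂μp =
      ∫ r in Ioi (0 : ℝ), r ^ (n - 1) * kε r * I r := rfl
  rw [e3, e2, ← integral_const_mul ε, ← integral_const_mul c, ← integral_const_mul 4⁻¹,
    ← integral_const_mul (4⁻¹ * c)]
  refine setIntegral_congr_fun measurableSet_Ioi fun x hx => ?_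
  have hx0 : (0 : ℝ) < x := hx
  simp only [hkε]
  have hεn : ε ^ n = ε ^ (n - 1) * ε := (pow_sub_one_mul (by omega) ε).symm
  have hxn : x ^ n = x ^ (n - 1) * x := (pow_sub_one_mul (by omega) x).symm
  rw [show ε⁻¹ * (ε * x) = x by field_simp, mul_pow, hεn, hxn]
  field_simp

end RadialFormula

/-! ## The 4/3 law from a uniform defect -/

section FourThirds

variable {T : ℝ} {u : ℝ → UnitAddTorus d → EuclideanSpace ℝ d} {D : STFunctional d}

/-- In dimension zero the sphere-averaged energy flux vanishes identically (the unit sphere of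
`ℝ⁰` is empty, and Mathlib's average over the zero measure is `0`). [folklore] -/
theorem energyFluxSphereAvg_of_isEmpty [IsEmpty d] (w : UnitAddTorus d → EuclideanSpace ℝ d) (ℓ : ℝ)
    (x : UnitAddTorus d) : energyFluxSphereAvg w ℓ x = 0 := by
  have hE : IsEmpty ↥(sphere (0 : EuclideanSpace ℝ d) 1) := by
    refine ⟨fun ω => ?_⟩
    have h1 : ‖(ω : EuclideanSpace ℝ d)‖ = 1 := norm_eq_of_mem_sphere ω
    have h0 : ‖(ω : EuclideanSpace ℝ d)‖ = 0 := by
      rw [EuclideanSpace.norm_eq]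
      simp
    linarith
  have hσ : (volume : Measure (EuclideanSpace ℝ d)).toSphere = 0 := Measure.eq_zero_of_isEmpty _
  simp [energyFluxSphereAvg, sphereAvg, hσ]

/-- **The local 4/3 law from a uniform Duchon–Robert defect** (every dimension). If `u ∈
L³((0,T) × T^d)` is jointly measurable and `D` is its Duchon–Robert defect *uniformly in the
mollifier* (`HasUniformDuchonRobertDefect`), then the sphere-averaged energy flux satisfies the
local 4/3 law `Torus.HasFourThirdsLaw T u D`:
`lim_{ℓ → 0⁺} ∫₀ᵀ∫ ℓ⁻¹ ⨍ δ_L u |δu|²(ℓω) dω ψ = −(4/d) D ψ`.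
Proof: for the plateau mollifiers `φ_m ↑ 𝟙_B/|B|` (radial, supported in the unit ball) the
Duchon–Robert pairing at scale `ℓ` is `−(d/4)` times a weighted average of the shell function
`G(r) = r⁻¹ I(r)` over `r ∈ [ℓ(1 − 1/m), ℓ]` (`integral_duchonRobertApprox_eq_radial`), which
tends to `−(d/4) G(ℓ)` as `m → ∞` by continuity of `G` (`continuous_shellPairing`,
`tendsto_integral_pow_mul_deriv_profile_mul`); uniformity in `m` of the `ℓ → 0⁺` limit then gives
`−(d/4) G(ℓ) → D ψ`. This is the upgrade "mollified limits ⇒ shell limit" that the Euler equation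
furnishes in Duchon–Robert 2000, §5 / Eyink 2003, (1.5)–(1.6), isolated from the Euler equation.
[folklore] -/
theorem HasUniformDuchonRobertDefect.hasFourThirdsLaw (h : HasUniformDuchonRobertDefect T u D)
    (hum : AEStronglyMeasurable (FunctionSpaces.Torus.stLift u) (volume.restrict (Ioo 0 T ×ˢ univ)))
    (hu3 : ∫⁻ t in Ioo 0 T, ∫⁻ x, ‖u t x‖ₑ ^ (3 : ℕ) < ∞) :
    HasFourThirdsLaw T u D := by
  intro ψ hψ
  rcases isEmpty_or_nonempty d with hd | hd
  · -- dimension zero: both sides vanish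
    have hc0 : fourThirdsConst d = 0 := by simp [fourThirdsConst, Fintype.card_eq_zero]
    simp only [energyFluxSphereAvg_of_isEmpty, mul_zero, zero_mul, integral_zero, hc0, neg_zero]
    exact tendsto_const_nhds
  -- product-measure form of the hypotheses
  set μp : Measure (ℝ × UnitAddTorus d) := (volume.restrict (Ioo 0 T)).prod volume with hμp
  have hu : AEStronglyMeasurable (uncurry u) μp := aestronglyMeasurable_uncurry_prod_of_stLift_Ioo hum
  have hu3' : ∫⁻ p, ‖uncurry u p‖ₑ ^ 3 ∂μp < ∞ := lintegral_prod_enorm_pow_three_lt_top hu hu3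
  have hψm : AEStronglyMeasurable (uncurry ψ) μp := hψ.continuous_uncurry.aestronglyMeasurable
  obtain ⟨Cψ, hψb⟩ := hψ.exists_abs_le
  set n : ℕ := Fintype.card d with hndef
  have hn : 1 ≤ n := Fintype.card_pos
  have hn0 : (0 : ℝ) < n := by exact_mod_cast hn
  set c : ℝ := (volume : Measure (EuclideanSpace ℝ d)).toSphere.real univ with hcdef
  have hc : 0 < c := toSphere_real_univ_pos
  obtain ⟨e₀, he₀⟩ : ∃ e : EuclideanSpace ℝ d, ‖e‖ = 1 := by
    classical
    obtain ⟨i⟩ := hd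
    exact ⟨EuclideanSpace.single i 1, by simp⟩
  -- the shell function `G(ℓ) = ℓ⁻¹ I(ℓ)` and its continuity on `(0, ∞)`
  set G : ℝ → ℝ := fun ℓ => ℓ⁻¹ * energyFluxShellPairing T u ψ ℓ with hGdef
  have hGiter : ∀ ℓ, ∫ t in Ioo 0 T, ∫ x, ℓ⁻¹ * energyFluxSphereAvg (u t) ℓ x * ψ t x = G ℓ :=
    fun ℓ => integral_inv_mul_energyFluxSphereAvg_eq hu hu3' hψm hψb ℓ
  have hGcont : ContinuousOn G (Ioi 0) :=
    (continuousOn_inv₀.mono fun ℓ hℓ => ne_of_gt hℓ).mul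
      (continuous_shellPairing hu hu3' hψm hψb).continuousOn
  rw [tendsto_congr hGiter]
  have hL : -fourThirdsConst d * D ψ = -(4 / (n : ℝ)) * D ψ := by rw [fourThirdsConst]
  rw [hL, Metric.tendsto_nhdsWithin_nhds]
  intro η hη
  obtain ⟨ε₀, hε₀, hU⟩ := h.exists_forall_abs_sub_lt hψ (η := (n : ℝ) / 4 * (η / 2)) (by positivity)
  refine ⟨ε₀, hε₀, fun ℓ hℓ hℓd => ?_⟩
  have hℓ0 : 0 < ℓ := hℓ
  have hℓε : ℓ ∈ Ioo 0 ε₀ := ⟨hℓ0, by rwa [Real.dist_eq, sub_zero, abs_of_pos hℓ0] at hℓd⟩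
  -- the plateau mollifiers at scale `ℓ`: uniformly close to `D ψ` …
  have hm : ∀ k : ℕ, (1 : ℝ) < (k : ℝ) + 2 := fun k => by
    have : (0 : ℝ) ≤ k := Nat.cast_nonneg k
    linarith
  have hA : ∀ k : ℕ, ∫ t in Ioo 0 T, ∫ x, duchonRobertApprox (plateauMollifier d ((k : ℝ) + 2)) ℓ (u t) x * ψ t x =
      4⁻¹ * c * ∫ x in Ioi (0 : ℝ), x ^ n *
        deriv (fun r : ℝ => plateauMollifier d ((k : ℝ) + 2) (r • e₀)) x * G (ℓ * x) := fun k =>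
    integral_duchonRobertApprox_eq_radial (isUnitBallMollifier_plateauMollifier (hm k))
      (fun x y hxy => plateauMollifier_radial _ hxy) he₀ hu hu3' hψm hψb hℓ0
  have hlt : ∀ k : ℕ, |4⁻¹ * c * (∫ x in Ioi (0 : ℝ), x ^ n *
        deriv (fun r : ℝ => plateauMollifier d ((k : ℝ) + 2) (r • e₀)) x * G (ℓ * x)) - D ψ| <
      (n : ℝ) / 4 * (η / 2) := fun k => by
    rw [← hA k]
    exact hU _ (isUnitBallMollifier_plateauMollifier (hm k)) ℓ hℓε
  -- … and converging to `−(d/4) G(ℓ)` as `k → ∞`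
  have hJ := tendsto_integral_pow_mul_deriv_profile_mul (d := d) he₀ hGcont hℓ0
  have hconv : Tendsto (fun k : ℕ => |4⁻¹ * c * (∫ x in Ioi (0 : ℝ), x ^ n *
        deriv (fun r : ℝ => plateauMollifier d ((k : ℝ) + 2) (r • e₀)) x * G (ℓ * x)) - D ψ|) atTop
      (𝓝 (|4⁻¹ * c * (-(n : ℝ) / c * G ℓ) - D ψ|)) :=
    ((hJ.const_mul (4⁻¹ * c)).sub_const (D ψ)).abs
  have hkey : |4⁻¹ * c * (-(n : ℝ) / c * G ℓ) - D ψ| ≤ (n : ℝ) / 4 * (η / 2) :=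
    le_of_tendsto' hconv fun k => (hlt k).le
  rw [show 4⁻¹ * c * (-(n : ℝ) / c * G ℓ) = -((n : ℝ) / 4) * G ℓ by field_simp] at hkey
  -- conclude
  rw [Real.dist_eq]
  calc |G ℓ - -(4 / (n : ℝ)) * D ψ| = 4 / (n : ℝ) * |-((n : ℝ) / 4) * G ℓ - D ψ| := by
        rw [show G ℓ - -(4 / (n : ℝ)) * D ψ = -(4 / (n : ℝ)) * (-((n : ℝ) / 4) * G ℓ - D ψ) by
          field_simp; ring]
        rw [abs_mul, abs_neg, abs_of_pos (by positivity)]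
    _ ≤ 4 / (n : ℝ) * ((n : ℝ) / 4 * (η / 2)) := by gcongr
    _ = η / 2 := by field_simp
    _ < η := by linarith

/-- Two defects that agree on test functions supported in `(0,T)` have the same 4/3 law. [folklore] -/
theorem HasFourThirdsLaw.congr_defect {D D' : STFunctional d}
    (hDD' : ∀ ψ : ℝ → UnitAddTorus d → ℝ, FunctionSpaces.Torus.IsSpaceTimeTestIoo T ψ → D ψ = D' ψ)
    (h : HasFourThirdsLaw T u D) : HasFourThirdsLaw T u D' := by
  intro ψ hψ
  rw [← hDD' ψ hψ]
  exact h ψ hψ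

/-- **The 4/3 law for a field with some uniform defect.** If `u ∈ L³` (jointly measurable) has
Duchon–Robert defect `D` and *a* uniform defect `D'`, then the 4/3 law holds with `D` (the two
defects agree on test functions, `HasDuchonRobertDefect.unique`). [folklore] -/
theorem HasDuchonRobertDefect.hasFourThirdsLaw_of_hasUniformDuchonRobertDefect {D D' : STFunctional d}
    (h : HasDuchonRobertDefect T u D) (hU : HasUniformDuchonRobertDefect T u D')
    (hum : AEStronglyMeasurable (FunctionSpaces.Torus.stLift u) (volume.restrict (Ioo 0 T ×ˢ univ)))
    (hu3 : ∫⁻ t in Ioo 0 T, ∫⁻ x, ‖u t x‖ₑ ^ (3 : ℕ) < ∞) :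
    HasFourThirdsLaw T u D :=
  (hU.hasFourThirdsLaw hum hu3).congr_defect fun _ hψ => (hU.hasDuchonRobertDefect.unique h hψ)

/-- **Reduction of the accepted fact `HasDuchonRobertDefect.hasFourThirdsLaw`.** The accepted
(unconditional) 4/3 law for `L³` weak Euler solutions follows as soon as every such solution with
a Duchon–Robert defect has a *uniform* Duchon–Robert defect — the uniformity in the mollifier
that Duchon–Robert's proof of their Prop. 2 provides through the local energy identity at scale
`ε` (with the `L^{3/2}` pressure of `Torus.exists_pressure_of_tendsto_L3`); see the module
docstring for the decomposition. [folklore] -/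
theorem hasFourThirdsLaw_of_forall_hasUniformDuchonRobertDefect
    (hunif : ∀ [DecidableEq d] {D : STFunctional d}, HasDuchonRobertDefect T u D →
      FunctionSpaces.Torus.IsWeakEulerSolutionOn T u →
      (∫⁻ t in Ioo 0 T, ∫⁻ x, ‖u t x‖ₑ ^ (3 : ℕ) < ∞) →
      ∃ D' : STFunctional d, HasUniformDuchonRobertDefect T u D') :
    HasDuchonRobertDefect.hasFourThirdsLaw (T := T) (u := u) := by
  intro _ D h hE hu3
  obtain ⟨D', hD'⟩ := hunif h hE hu3
  exact h.hasFourThirdsLaw_of_hasUniformDuchonRobertDefect hD' hE.1 hu3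

end FourThirds

/-! ## The uniform defect is a genuine condition: the zero field -/

section ZeroField

variable {T : ℝ} {D : STFunctional d}

/-- The Duchon–Robert flux of the zero velocity field vanishes identically (all increments
vanish). [folklore] -/
@[simp]
theorem duchonRobertApprox_zero_field (φ : EuclideanSpace ℝ d → ℝ) (ε : ℝ) (x : UnitAddTorus d) :
    duchonRobertApprox φ ε (0 : UnitAddTorus d → EuclideanSpace ℝ d) x = 0 := by
  simp [duchonRobertApprox, increment]

/-- **The zero field has uniform Duchon–Robert defect `0`** (every dimension): the notion
`HasUniformDuchonRobertDefect` is inhabited. [folklore] -/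
theorem hasUniformDuchonRobertDefect_zero (T : ℝ) :
    HasUniformDuchonRobertDefect T (0 : ℝ → UnitAddTorus d → EuclideanSpace ℝ d) 0 :=
  hasUniformDuchonRobertDefect_of_forall_exists fun ψ _ η hη =>
    ⟨1, one_pos, fun φ _ ε _ => by simpa using hη⟩

/-- **The zero field has uniform defect `D` iff `D` annihilates every test function supported in
`(0,T)`** (`d` nonempty, so that unit-ball mollifiers exist: `isUnitBallMollifier_plateauMollifier`).
In particular `HasUniformDuchonRobertDefect T u D` is a condition on the pair `(u, D)`, not a
statement valid for all `(T, u, D)`. [folklore] -/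
theorem hasUniformDuchonRobertDefect_zero_iff [Nonempty d] :
    HasUniformDuchonRobertDefect T (0 : ℝ → UnitAddTorus d → EuclideanSpace ℝ d) D ↔
      ∀ ψ : ℝ → UnitAddTorus d → ℝ, FunctionSpaces.Torus.IsSpaceTimeTestIoo T ψ → D ψ = 0 := by
  refine ⟨fun h ψ hψ => ?_, fun h => hasUniformDuchonRobertDefect_of_forall_exists fun ψ hψ η hη =>
    ⟨1, one_pos, fun φ _ ε _ => by simpa [h ψ hψ] using hη⟩⟩
  by_contra hD
  obtain ⟨ε₀, hε₀, hb⟩ := h.exists_forall_abs_sub_lt hψ (abs_pos.2 hD)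
  have hlt := hb _ (isUnitBallMollifier_plateauMollifier (d := d) (one_lt_two : (1 : ℝ) < 2)) (ε₀ / 2)
    ⟨by positivity, by linarith⟩
  have h0 : (∫ t in Ioo 0 T, ∫ x, duchonRobertApprox (plateauMollifier d 2) (ε₀ / 2)
      ((0 : ℝ → UnitAddTorus d → EuclideanSpace ℝ d) t) x * ψ t x) = 0 := by
    simp
  rw [h0, zero_sub, abs_neg] at hlt
  exact lt_irrefl _ hlt

/-- `HasUniformDuchonRobertDefect` is **not universally valid**: the zero field does not have the
constant functional `1` as a uniform Duchon–Robert defect (`d` nonempty; the zero test function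
witnesses it). [folklore] -/
theorem not_hasUniformDuchonRobertDefect_zero_one [Nonempty d] (T : ℝ) :
    ¬ HasUniformDuchonRobertDefect T (0 : ℝ → UnitAddTorus d → EuclideanSpace ℝ d) (fun _ => 1) :=
  fun h => one_ne_zero (hasUniformDuchonRobertDefect_zero_iff.1 h 0
    ⟨FunctionSpaces.Torus.isSpaceTimeTest_zero T, 1, one_pos, fun _ _ => rfl⟩)

end ZeroField

end Literature.Analysis.FluidPDE.Torus
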